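import Literature.Computability.QuantumComplexity.PerSearchScanBrick
import Literature.Computability.QuantumComplexity.PerSearchTailBrick
import HarnessLib

/-!
# `randSearchAlg_isPolyTime` discharged: the transcript step function of the AA13 permanent search is in `FP`

This file closes the named fact `PerSearch.randSearchAlg_isPolyTime` of `PermanentSearchRandom.lean`
(`randSearchAlg_isPolyTime_holds`, at the end). Part I realises the two loops of the tree's two-loop
model of the search as `FP` bricks; Part II assembles the step machine and proves that it computes
`toStep (randComp G c q₀ u)`.

## Part I — the two loops: descending (pre-phases) and ascending (post-phases)

Aaronson–Arkhipov, *The computational complexity of linear optics*, Theory of Computing 9 (2013),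
proof of Thm. 4.3 (pp. 176–177): "Our reduction will use recursion on `n`". The tree straightens the
recursion of `perLevel` into the two-loop model of `PermanentSearchReplay.lean`: `descend mk g n X fs as`
runs the pre-phases (`levelPre`) level by level pushing a `Frame` per level, and `ascend mk g P_Y fs as`
runs the post-phases (`levelPost`) of the collected frames (`descend_eq`, `toStep_randComp`). This file
realises both loops on string records, on top of the bricks `headF` (`PerSearchScanBrick.lean`,
`headF_apply`) and `tailF` (`PerSearchTailBrick.lean`, `tailF_levelPost`):

* `WFrame` — a frame whose matrix is the matrix of a word (`toFrame`), its code `frEnc`, the frame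
  stack code `frsEnc` (`encList`); `descFrames` — the descent returning the frame stack (so that
  `descend = descFrames` then `ascend`, `descend_eq_descFrames`) and its word form `descFramesW`
  (`descFrames_wmat`: the descent from the matrix of a word produces word frames, the minors being
  `minorW ∘ permW`);
* `descStep`/`descLoopF` — the descending loop on `⟨S, ⟨transcript, ⟨⟨w, 1ⁿ⟩, ⟨frames, value⟩⟩⟩⟩`
  (dimension `0`: base value `1`; else `headF`: pending, exit with value `0`, or push the frame and
  continue on the minor word), capped (`rcapF`, allowance `DSp`) and in `FP` unconditionally, with
  **`descLoopF_apply`**: its final state codes `descFramesW (randMaker G c q₀ u) n w …`;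
* `ascStep`/`ascLoopF` — the ascending loop on `⟨S, ⟨transcript, ⟨bin P_Y, frames⟩⟩⟩` (pop a frame, run
  `tailF` on the permuted word, pending or continue with the returned value), capped (allowance `ASp`,
  the returned values being `< 2^{pyE}` by `levelPost_value_lt`) and in `FP`, with **`ascLoopF_apply`**:
  its final state codes `ascend (randMaker G c q₀ u) G P_Y (frames.map toFrame) as`.

## References

* S. Aaronson, A. Arkhipov, *The computational complexity of linear optics*, Theory of Computing 9
  (2013), proof of Thm. 4.3 (pp. 176–177).
* S. Arora, B. Barak, *Computational Complexity: A Modern Approach*, CUP 2009, §1.3, §1.4.1, §3.4.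
-/

noncomputable section

namespace Literature.Computability.QuantumComplexity

open _root_.Computability Complexity Complexity.Brick Complexity.Plumb Complexity.OracleComp Matrix
  Literature.Computability.AlgebraicComplexity Polynomial

namespace PerSearch

/-! ### Word frames and the descent returning the frame stack -/

/-- **A frame whose matrix is the matrix of a word**: dimension `n + 1`, the row-major word, the pivot,
the first value. [folklore] -/
structure WFrame where
  /-- the dimension of the minor (the level is `n + 1`) -/
  n : ℕ
  /-- the row-major word of the level's matrix -/
  w : List Bool
  /-- the word has the right length -/
  hw : w.length = (n + 1) * (n + 1)
  /-- the pivot row -/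
  p : Fin (n + 1)
  /-- the value received for the matrix -/
  v0 : ℕ

/-- The frame of the two-loop model coded by a word frame. [folklore] -/
def WFrame.toFrame (f : WFrame) : Frame := ⟨f.n, wmat (f.n + 1) f.w, f.p, f.v0⟩

/-- **The code of a frame**: `⟨w, ⟨1^{n+1}, ⟨1ᵖ, bin v₀⟩⟩⟩`. [folklore] -/
def frEnc (f : WFrame) : List Bool := boolPair f.w (boolPair (ones (f.n + 1)) (boolPair (ones f.p) (encodeNat f.v0)))

/-- **The code of the frame stack** (innermost first). [folklore] -/
def frsEnc (fs : List WFrame) : List Bool := encList (fs.map frEnc)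

/-- The stack code of a push. [folklore] -/
@[simp] theorem frsEnc_cons (f : WFrame) (fs : List WFrame) : frsEnc (f :: fs) = boolPair (frEnc f) (frsEnc fs) := by
  simp [frsEnc, encList_cons]

/-- The empty stack. [folklore] -/
@[simp] theorem frsEnc_nil : frsEnc [] = [] := rfl

section Desc

variable (mk : Maker) (g : ℕ)

/-- **The descent returning the frame stack**: as `descend`, but handing back the base value, the frames
and the leftover transcript instead of calling `ascend`. [cite: AaronsonArkhipovToC2013, proof of Thm. 4.3 (pp. 176–177)] -/
def descFrames : (n : ℕ) → Matrix (Fin n) (Fin n) ℤ → List Frame → List (List Bool) → List Bool ⊕ (ℕ × List Frame × List (List Bool))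
  | 0, _, fs, as => Sum.inr (1, fs, as)
  | n + 1, X, fs, as =>
    match replay (levelPre mk X) as with
    | Sum.inl q => Sum.inl q
    | Sum.inr (none, as') => Sum.inr (0, fs, as')
    | Sum.inr (some (p, v0), as') => descFrames n (minorOf X p) (⟨n, X, p, v0⟩ :: fs) as'

/-- **`descend` is the descent followed by the ascent.** [cite: AaronsonArkhipovToC2013, proof of Thm. 4.3 (pp. 176–177)] -/
theorem descend_eq_descFrames : ∀ (n : ℕ) (X : Matrix (Fin n) (Fin n) ℤ) (fs : List Frame) (as : List (List Bool)),
    descend mk g n X fs as =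
      match descFrames mk n X fs as with
      | Sum.inl q => Sum.inl q
      | Sum.inr (v, fs', as') => ascend mk g v fs' as'
  | 0, X, fs, as => rfl
  | n + 1, X, fs, as => by
    rw [descend, descFrames]
    rcases replay (levelPre mk X) as with q | ⟨_ | ⟨p, v0⟩, as'⟩
    · rfl
    · rfl
    · exact descend_eq_descFrames n (minorOf X p) _ as'

/-- The word of the minor of the permuted word has the right length. [folklore] -/
theorem length_minorW_permW {n : ℕ} {w : List Bool} (hw : w.length = (n + 1) * (n + 1)) (p : Fin (n + 1)) :
    (minorW n (permW (n + 1) w p)).length = n * n :=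
  length_minorW (by rw [length_permW hw p.2])

/-- **The descent on words**: the frames pushed are word frames, the minor is the minor word of the permuted
word. [cite: AaronsonArkhipovToC2013, proof of Thm. 4.3 (pp. 176–177)] -/
def descFramesW : (n : ℕ) → (w : List Bool) → w.length = n * n → List WFrame → List (List Bool) →
    List Bool ⊕ (ℕ × List WFrame × List (List Bool))
  | 0, _, _, fs, as => Sum.inr (1, fs, as)
  | n + 1, w, hw, fs, as =>
    match replay (levelPre mk (wmat (n + 1) w)) as with
    | Sum.inl q => Sum.inl q
    | Sum.inr (none, as') => Sum.inr (0, fs, as')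
    | Sum.inr (some (p, v0), as') => descFramesW n (minorW n (permW (n + 1) w p)) (length_minorW_permW hw p) (⟨n, w, hw, p, v0⟩ :: fs) as'

/-- The recursion's minor of the matrix of a word is the matrix of the minor word. [folklore] -/
theorem minorOf_wmat {n : ℕ} (w : List Bool) (hw : w.length = (n + 1) * (n + 1)) (p : Fin (n + 1)) :
    minorOf (wmat (n + 1) w) p = wmat n (minorW n (permW (n + 1) w p)) := by
  rw [minorOf_eq, submatrix_succAbove_eq_wmat w hw p]

/-- **The descent from the matrix of a word is the descent on words.** [folklore] -/
theorem descFrames_wmat : ∀ (n : ℕ) (w : List Bool) (hw : w.length = n * n) (fs : List WFrame) (as : List (List Bool)),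
    descFrames mk n (wmat n w) (fs.map WFrame.toFrame) as =
      (descFramesW mk n w hw fs as).map id fun r => (r.1, r.2.1.map WFrame.toFrame, r.2.2)
  | 0, w, hw, fs, as => rfl
  | n + 1, w, hw, fs, as => by
    rw [descFrames, descFramesW]
    rcases replay (levelPre mk (wmat (n + 1) w)) as with q | ⟨_ | ⟨p, v0⟩, as'⟩
    · rfl
    · rfl
    · dsimp only
      rw [minorOf_wmat w hw p, ← descFrames_wmat n _ (length_minorW_permW hw p) (⟨n, w, hw, p, v0⟩ :: fs) as']
      rfl

end Desc

/-! ### The descending loop -/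

/-- **The state of the descending loop**: status (`ε` descending, `0` done, `1 q` pending), transcript, the
current word with its dimension `⟨w, 1ⁿ⟩`, the frame stack, the base value when done. [folklore] -/
def dEnc (S : List Bool) (as : List (List Bool)) (cur frs V : List Bool) : List Bool :=
  boolPair S (boolPair (ansEnc as) (boolPair cur (boolPair frs V)))

/-- The current word of dimension `n` with its dimension. [folklore] -/
def cw (n : ℕ) (w : List Bool) : List Bool := boolPair w (ones n)

/-- Status of the descent state. [folklore] -/
def dS : List Bool → List Bool := nthF 0
/-- Transcript. [folklore] -/
def dAS : List Bool → List Bool := nthF 1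
/-- Current word and dimension. [folklore] -/
def dCur : List Bool → List Bool := nthF 2
/-- Frame stack. [folklore] -/
def dFRS : List Bool → List Bool := nthF 3
/-- Base value. [folklore] -/
def dV : List Bool → List Bool := sndPow 3

section DProj
variable (S : List Bool) (as : List (List Bool)) (cur frs V : List Bool)
/-- Value of `dS`. [folklore] -/
@[simp] theorem dS_dEnc : dS (dEnc S as cur frs V) = S := by simp [dS, dEnc]
/-- Value of `dAS`. [folklore] -/
@[simp] theorem dAS_dEnc : dAS (dEnc S as cur frs V) = ansEnc as := by simp [dAS, dEnc, nthF]
/-- Value of `dCur`. [folklore] -/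
@[simp] theorem dCur_dEnc : dCur (dEnc S as cur frs V) = cur := by simp [dCur, dEnc, nthF]
/-- Value of `dFRS`. [folklore] -/
@[simp] theorem dFRS_dEnc : dFRS (dEnc S as cur frs V) = frs := by simp [dFRS, dEnc, nthF]
/-- Value of `dV`. [folklore] -/
@[simp] theorem dV_dEnc : dV (dEnc S as cur frs V) = V := by simp [dV, dEnc, sndPow]
/-- The descent state without its status. [folklore] -/
@[simp] theorem sndF_dEnc' : sndF (dEnc S as cur frs V) = boolPair (ansEnc as) (boolPair cur (boolPair frs V)) := by simp [dEnc]
end DProj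

/-- The projections are in `FP`. [cite: AroraBarak2009, §1.3] -/
theorem dproj_mem_FP : dS ∈ FP ∧ dAS ∈ FP ∧ dCur ∈ FP ∧ dFRS ∈ FP ∧ dV ∈ FP :=
  ⟨nthF_mem_FP 0, nthF_mem_FP 1, nthF_mem_FP 2, nthF_mem_FP 3, sndPow_mem_FP 3⟩

/-- On the loop record: **the head record** `⟨inp, ⟨current, transcript⟩⟩` for `headF`. [folklore] -/
def hRecF : List Bool → List Bool := fanoutFn (nthF 0) (fanoutFn (dCur ∘ lSt) (dAS ∘ lSt))

/-- Value of `hRecF` at positive dimension: a `headRec`. [folklore] -/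
theorem hRecF_rec (inp cnt S : List Bool) (as : List (List Bool)) (n : ℕ) (w frs V : List Bool) :
    hRecF (boolPair inp (boolPair cnt (dEnc S as (cw (n + 1) w) frs V))) = headRec inp n w as := by
  simp [hRecF, headRec, cw, nthF]

/-- `hRecF ∈ FP`. [cite: AroraBarak2009, §1.3] -/
theorem hRecF_mem_FP : hRecF ∈ FP :=
  fanoutFn_mem_FP (nthF_mem_FP 0) (fanoutFn_mem_FP (comp_mem_FP dproj_mem_FP.2.2.1 lSt_mem_FP) (comp_mem_FP dproj_mem_FP.2.1 lSt_mem_FP))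

/-- On `⟨loop record, head output⟩`: **the new current word** `⟨minor word of the permuted word, 1ⁿ⟩`. [folklore] -/
def newCurF : List Bool → List Bool :=
  let cur := dCur ∘ lSt ∘ fstF
  let J := nthF 2 ∘ sndF
  fanoutFn (minorWF ∘ fanoutFn (permWF ∘ fanoutFn cur J) (dropFn ∘ fanoutFn (fun _ => [true]) (sndF ∘ cur)))
    (dropFn ∘ fanoutFn (fun _ => [true]) (sndF ∘ cur))

/-- Value of `newCurF`. [folklore] -/
theorem newCurF_apply (inp cnt S : List Bool) (as : List (List Bool)) {n : ℕ} {w : List Bool} (hw : w.length = (n + 1) * (n + 1))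
    (frs V S' AS' : List Bool) {p : ℕ} (hp : p < n + 1) (V0 : List Bool) :
    newCurF (boolPair (boolPair inp (boolPair cnt (dEnc S as (cw (n + 1) w) frs V))) (boolPair S' (boolPair AS' (boolPair (ones p) V0)))) =
      cw n (minorW n (permW (n + 1) w p)) := by
  simp only [newCurF, fanoutFn_apply, Function.comp_apply, fstF_boolPair, sndF_boolPair, lSt_rec, dCur_dEnc, cw, nthF, dropFn_boolPair,
    List.length_singleton]
  rw [show (ones (n + 1)).drop 1 = ones n by simp [ones], permWF_apply w hw hp, minorWF_apply]

/-- `newCurF ∈ FP`. [cite: AroraBarak2009, §1.3] -/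
theorem newCurF_mem_FP : newCurF ∈ FP := by
  have hcur : (dCur ∘ lSt ∘ fstF) ∈ FP := comp_mem_FP dproj_mem_FP.2.2.1 (comp_mem_FP lSt_mem_FP fstF_mem_FP)
  have hJ : (nthF 2 ∘ sndF) ∈ FP := comp_mem_FP (nthF_mem_FP 2) sndF_mem_FP
  have hK : (dropFn ∘ fanoutFn (fun _ => [true]) (sndF ∘ dCur ∘ lSt ∘ fstF)) ∈ FP :=
    comp_mem_FP dropFn_mem_FP (fanoutFn_mem_FP (const_mem_FP _) (comp_mem_FP sndF_mem_FP hcur))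
  exact fanoutFn_mem_FP (comp_mem_FP minorWF_mem_FP (fanoutFn_mem_FP (comp_mem_FP permWF_mem_FP (fanoutFn_mem_FP hcur hJ)) hK)) hK

/-- On `⟨loop record, head output ⟨S', ⟨AS', ⟨J, V₀⟩⟩⟩⟩`: **the new descent state** — pending (status copied);
pivot found (`S' = 0`): push the frame `⟨w, ⟨1^{n+1}, ⟨J, V₀⟩⟩⟩` and continue on the minor word; else done with value `0`. [cite: AaronsonArkhipovToC2013, proof of Thm. 4.3 (p. 176)] -/
def afterHeadF : List Bool → List Bool :=
  let st := lSt ∘ fstF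
  let S' := fstF ∘ sndF
  let AS' := nthF 1 ∘ sndF
  iteFn (eqPairFn ∘ fanoutFn (take1Fn ∘ S') fun _ => [true])
    (fanoutFn S' (fanoutFn AS' (sndPow 1 ∘ st)))
    (iteFn (eqPairFn ∘ fanoutFn S' fun _ => [false])
      (fanoutFn (fun _ => []) (fanoutFn AS' (fanoutFn newCurF
        (fanoutFn (fanoutFn (fanoutFn (fstF ∘ dCur ∘ st) (fanoutFn (sndF ∘ dCur ∘ st) (sndPow 1 ∘ sndF))) (dFRS ∘ st)) (dV ∘ st)))))
      (fanoutFn (fun _ => [false]) (fanoutFn AS' (fanoutFn (dCur ∘ st) (fanoutFn (dFRS ∘ st) fun _ => [])))))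

/-- `afterHeadF ∈ FP`. [cite: AroraBarak2009, §1.3] -/
theorem afterHeadF_mem_FP : afterHeadF ∈ FP := by
  obtain ⟨_, _, hCur, hFRS, hVv⟩ := dproj_mem_FP
  have hst : (lSt ∘ fstF) ∈ FP := comp_mem_FP lSt_mem_FP fstF_mem_FP
  have hS' : (fstF ∘ sndF) ∈ FP := comp_mem_FP fstF_mem_FP sndF_mem_FP
  have hAS' : (nthF 1 ∘ sndF) ∈ FP := comp_mem_FP (nthF_mem_FP 1) sndF_mem_FP
  exact iteFn_mem_FP (comp_mem_FP eqPairFn_mem_FP (fanoutFn_mem_FP (comp_mem_FP take1Fn_mem_FP hS') (const_mem_FP _)))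
    (fanoutFn_mem_FP hS' (fanoutFn_mem_FP hAS' (comp_mem_FP (sndPow_mem_FP 1) hst)))
    (iteFn_mem_FP (comp_mem_FP eqPairFn_mem_FP (fanoutFn_mem_FP hS' (const_mem_FP _)))
      (fanoutFn_mem_FP (const_mem_FP _) (fanoutFn_mem_FP hAS' (fanoutFn_mem_FP newCurF_mem_FP
        (fanoutFn_mem_FP (fanoutFn_mem_FP (fanoutFn_mem_FP (comp_mem_FP fstF_mem_FP (comp_mem_FP hCur hst))
          (fanoutFn_mem_FP (comp_mem_FP sndF_mem_FP (comp_mem_FP hCur hst)) (comp_mem_FP (sndPow_mem_FP 1) sndF_mem_FP)))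
          (comp_mem_FP hFRS hst)) (comp_mem_FP hVv hst)))))
      (fanoutFn_mem_FP (const_mem_FP _) (fanoutFn_mem_FP hAS' (fanoutFn_mem_FP (comp_mem_FP hCur hst)
        (fanoutFn_mem_FP (comp_mem_FP hFRS hst) (const_mem_FP _))))))

/-- **One level of the descent**: idle unless descending; dimension `0` — done with base value `1`; else the
pre-phase `headF` and `afterHeadF`. [cite: AaronsonArkhipovToC2013, proof of Thm. 4.3 (p. 176)] -/
def descStep (G : ℕ) (c q₀ : Polynomial ℕ) : List Bool → List Bool :=
  iteFn (isNilFn ∘ dS ∘ lSt)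
    (iteFn (isNilFn ∘ sndF ∘ dCur ∘ lSt)
      (fanoutFn (fun _ => [false]) (fanoutFn (dAS ∘ lSt) (fanoutFn (dCur ∘ lSt) (fanoutFn (dFRS ∘ lSt) fun _ => [true]))))
      (afterHeadF ∘ fanoutFn id (headF G c q₀ ∘ hRecF)))
    lSt

/-- `descStep G c q₀ ∈ FP`. [cite: AroraBarak2009, §1.3] -/
theorem descStep_mem_FP (G : ℕ) (c q₀ : Polynomial ℕ) : descStep G c q₀ ∈ FP := by
  obtain ⟨hSd, hASd, hCur, hFRS, _⟩ := dproj_mem_FP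
  exact iteFn_mem_FP (comp_mem_FP isNilFn_mem_FP (comp_mem_FP hSd lSt_mem_FP))
    (iteFn_mem_FP (comp_mem_FP isNilFn_mem_FP (comp_mem_FP sndF_mem_FP (comp_mem_FP hCur lSt_mem_FP)))
      (fanoutFn_mem_FP (const_mem_FP _) (fanoutFn_mem_FP (comp_mem_FP hASd lSt_mem_FP) (fanoutFn_mem_FP (comp_mem_FP hCur lSt_mem_FP)
        (fanoutFn_mem_FP (comp_mem_FP hFRS lSt_mem_FP) (const_mem_FP _)))))
      (comp_mem_FP afterHeadF_mem_FP (fanoutFn_mem_FP OracleCompose.id_mem_FP (comp_mem_FP (headF_mem_FP G c q₀) hRecF_mem_FP))))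
    lSt_mem_FP

section DStep

variable (G : ℕ) (c q₀ : Polynomial ℕ) (u A cnt : List Bool)

/-- A state that is not descending is fixed. [folklore] -/
theorem descStep_of_ne_nil {S : List Bool} (hS : S ≠ []) (as : List (List Bool)) (cur frs V : List Bool) :
    descStep G c q₀ (boolPair (boolPair u A) (boolPair cnt (dEnc S as cur frs V))) = dEnc S as cur frs V := by
  rw [descStep, iteFn_apply (b := false) (by simp [isNilFn, hS])]; simp

/-- Dimension `0`: done with base value `1`. [folklore] -/
theorem descStep_zero (as : List (List Bool)) (w frs V : List Bool) :
    descStep G c q₀ (boolPair (boolPair u A) (boolPair cnt (dEnc [] as (cw 0 w) frs V))) = dEnc [false] as (cw 0 w) frs (encodeNat 1) := by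
  rw [descStep, iteFn_apply (b := true) (by simp [isNilFn]), iteFn_apply (b := true) (by simp [isNilFn, cw, ones])]
  simp only [if_true, fanoutFn_apply, Function.comp_apply, lSt_rec, dAS_dEnc, dCur_dEnc, dFRS_dEnc, (by decide : encodeNat 1 = [true])]
  rfl

/-- **Positive dimension: the pre-phase decides** (`|w| = (n+1)²`, `n + 1 ≤ |inp|`): pending, done with `0`, or
push and continue on the minor word. [cite: AaronsonArkhipovToC2013, proof of Thm. 4.3 (p. 176)] -/
theorem descStep_succ (as : List (List Bool)) {n : ℕ} {w : List Bool} (hw : w.length = (n + 1) * (n + 1)) (hnN : n + 1 ≤ (boolPair u A).length)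
    (fs : List WFrame) (V : List Bool) :
    descStep G c q₀ (boolPair (boolPair u A) (boolPair cnt (dEnc [] as (cw (n + 1) w) (frsEnc fs) V))) =
      match replay (levelPre (randMaker G c q₀ u) (wmat (n + 1) w)) as with
      | Sum.inl q => dEnc (true :: q) [] (cw (n + 1) w) (frsEnc fs) V
      | Sum.inr (none, as') => dEnc [false] as' (cw (n + 1) w) (frsEnc fs) []
      | Sum.inr (some (p, v0), as') => dEnc [] as' (cw n (minorW n (permW (n + 1) w p))) (frsEnc (⟨n, w, hw, p, v0⟩ :: fs)) V := by
  rw [descStep, iteFn_apply (b := true) (by simp [isNilFn]), iteFn_apply (b := false) (by simp [isNilFn, cw, ones])]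
  simp only [if_true, Bool.false_eq_true, if_false, Function.comp_apply, fanoutFn_apply, id, hRecF_rec, headF_apply G c q₀ u A hw hnN]
  rcases replay (levelPre (randMaker G c q₀ u) (wmat (n + 1) w)) as with q | ⟨_ | ⟨p, v0⟩, as'⟩
  · rw [headOut, afterHeadF, iteFn_apply (b := true) (by simp [take1Fn, eqPairFn_boolPair])]
    simp only [if_true, fanoutFn_apply, Function.comp_apply, fstF_boolPair, sndF_boolPair, lSt_rec, nthF, sndPow, sndF_dEnc']
    rfl
  · rw [headOut, afterHeadF, iteFn_apply (b := false) (by simp [take1Fn, eqPairFn_boolPair]),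
      iteFn_apply (b := false) (by simp [eqPairFn_boolPair])]
    simp only [Bool.false_eq_true, if_false, fanoutFn_apply, Function.comp_apply, fstF_boolPair, sndF_boolPair, lSt_rec, nthF, sndPow,
      dCur_dEnc, dFRS_dEnc]
    rfl
  · rw [headOut, afterHeadF, iteFn_apply (b := false) (by simp [take1Fn, eqPairFn_boolPair]),
      iteFn_apply (b := true) (by simp [eqPairFn_boolPair])]
    simp only [if_true, Bool.false_eq_true, if_false, fanoutFn_apply, Function.comp_apply, fstF_boolPair, sndF_boolPair, lSt_rec,
      dCur_dEnc, dFRS_dEnc, dV_dEnc, nthF, sndPow, newCurF_apply _ cnt [] as hw _ V _ _ p.2]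
    simp only [cw, fstF_boolPair, sndF_boolPair, dEnc, frsEnc_cons, frEnc]

end DStep

/-- States that are not descending are fixed by the rounds. [folklore] -/
theorem loopModel_descStep_of_ne_nil (G : ℕ) (c q₀ : Polynomial ℕ) (u A : List Bool) {S : List Bool} (hS : S ≠ []) (as : List (List Bool))
    (cur frs V : List Bool) : ∀ k : ℕ, loopModel (descStep G c q₀) (boolPair u A) k (dEnc S as cur frs V) = dEnc S as cur frs V
  | 0 => rfl
  | k + 1 => by rw [loopModel, descStep_of_ne_nil G c q₀ u A _ hS, loopModel_descStep_of_ne_nil G c q₀ u A hS as cur frs V k]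

/-- **The descending rounds follow `descFramesW`** (input `⟨u, A⟩`, `|w| = n²`, `n ≤ |inp|`, at least `n + 1`
rounds): pending `1 q` (transcript exhausted at the pre-phase), or done (`0`) with the leftover transcript, the
frame stack and the base value. [cite: AaronsonArkhipovToC2013, proof of Thm. 4.3 (pp. 176–177)] -/
theorem loopModel_descStep (G : ℕ) (c q₀ : Polynomial ℕ) (u A : List Bool) :
    ∀ (n : ℕ) (w : List Bool) (hw : w.length = n * n) (fs : List WFrame) (as : List (List Bool)) (V : List Bool) (k : ℕ),
      n + 1 ≤ k → n ≤ (boolPair u A).length →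
      match descFramesW (randMaker G c q₀ u) n w hw fs as with
      | Sum.inl q => ∃ rest, loopModel (descStep G c q₀) (boolPair u A) k (dEnc [] as (cw n w) (frsEnc fs) V) = boolPair (true :: q) rest
      | Sum.inr (v, fs', as') => ∃ cur, loopModel (descStep G c q₀) (boolPair u A) k (dEnc [] as (cw n w) (frsEnc fs) V) =
          dEnc [false] as' cur (frsEnc fs') (encodeNat v)
  | 0, w, hw, fs, as, V, k, hk, _ => by
    obtain ⟨k, rfl⟩ : ∃ k', k = k' + 1 := ⟨k - 1, by omega⟩
    refine ⟨cw 0 w, ?_⟩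
    rw [loopModel, descStep_zero, loopModel_descStep_of_ne_nil G c q₀ u A (List.cons_ne_nil _ _)]
  | n + 1, w, hw, fs, as, V, k, hk, hnN => by
    obtain ⟨k, rfl⟩ : ∃ k', k = k' + 1 := ⟨k - 1, by omega⟩
    rw [descFramesW]
    have hstep := descStep_succ G c q₀ u A (encodeNat (k + 1)) as hw hnN fs V
    rcases hro : replay (levelPre (randMaker G c q₀ u) (wmat (n + 1) w)) as with q | ⟨_ | ⟨p, v0⟩, as'⟩
    · rw [hro] at hstep
      refine ⟨boolPair (ansEnc []) (boolPair (cw (n + 1) w) (boolPair (frsEnc fs) V)), ?_⟩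
      rw [loopModel, hstep]
      exact loopModel_descStep_of_ne_nil G c q₀ u A (List.cons_ne_nil _ _) _ _ _ _ _
    · rw [hro] at hstep
      refine ⟨cw (n + 1) w, ?_⟩
      rw [loopModel, hstep]
      exact loopModel_descStep_of_ne_nil G c q₀ u A (List.cons_ne_nil _ _) _ _ _ _ _
    · rw [hro] at hstep
      dsimp only
      have ih := loopModel_descStep G c q₀ u A n (minorW n (permW (n + 1) w p)) (length_minorW_permW hw p) (⟨n, w, hw, p, v0⟩ :: fs) as' V k
        (by omega) (by omega)
      rw [loopModel, hstep]
      exact ih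

/-! ### Sizes of the descent and the capped descending loop -/

/-- Length of a descent state. [folklore] -/
theorem length_dEnc (S : List Bool) (as : List (List Bool)) (cur frs V : List Bool) :
    (dEnc S as cur frs V).length = 2 * S.length + 2 + (2 * (ansEnc as).length + 2 + (2 * cur.length + 2 + (2 * frs.length + 2 + V.length))) := by
  simp only [dEnc, length_boolPair]

/-- Length of the current-word field. [folklore] -/
theorem length_cw (n : ℕ) (w : List Bool) : (cw n w).length = 2 * w.length + 2 + n := by simp [cw, ones]

/-- Length of a frame code. [folklore] -/
theorem length_frEnc (f : WFrame) : (frEnc f).length = 2 * ((f.n + 1) * (f.n + 1)) + 2 + (2 * (f.n + 1) + 2 + (2 * f.p + 2 + (encodeNat f.v0).length)) := by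
  simp [frEnc, ones, f.hw]

/-- **A pending value query is polynomially bounded** (a `0/1` matrix of dimension `n + 1 ≤ N`). [cite: AaronsonArkhipovToC2013, proof of Thm. 4.3 (p. 176) with Def. 2.4 (p. 163)] -/
theorem length_valQuery_le (G : ℕ) (c q₀ : Polynomial ℕ) (u : List Bool) {n N : ℕ} (w : List Bool) (hnN : n + 1 ≤ N) (hx : (inX u).length ≤ N) :
    (randMaker G c q₀ u (n + 1, 0, 0, 0) ⟨n + 1, fun a b => wmat (n + 1) w a b⟩).length ≤ (qB1p G c q₀).eval N := by
  rw [randMaker_apply, length_perSqQuery, qB1p_eval]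
  have hM := length_encode_matrix_le (b := 1) (fun a b => wmat (n + 1) w a b)
    (fun a b => by
      have h01 := isZeroOne_wmat (n + 1) w a b
      rcases h01 with h | h <;> rw [h] <;> decide)
  have hc := length_chunk_le ((ellp G c q₀).eval (inX u).length)
    (inI u * (NSp G q₀).eval (inX u).length + siteIdx G q₀ (inX u).length (n + 1, 0, 0, 0)) (inR u)
  have h1 : LM (n + 1) 1 ≤ LM N 1 := LM_mono hnN le_rfl
  have h2 : (kp G q₀).eval (inX u).length ≤ (kp G q₀).eval N := TM2Iter.eval_mono _ hx
  have h3 : (ellp G c q₀).eval (inX u).length ≤ (ellp G c q₀).eval N := TM2Iter.eval_mono _ hx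
  simp only at hM ⊢
  omega

/-- A pending query of the pre-phase (value or pivot) is at most `qB1p(N)`. [folklore] -/
theorem length_levelPre_query_le (G : ℕ) (c q₀ : Polynomial ℕ) (u : List Bool) {n N : ℕ} {w : List Bool}
    (hnN : n + 1 ≤ N) (hx : (inX u).length ≤ N) {as : List (List Bool)} {q : List Bool}
    (h : replay (levelPre (randMaker G c q₀ u) (wmat (n + 1) w)) as = Sum.inl q) : q.length ≤ (qB1p G c q₀).eval N := by
  rw [replay_levelPre] at h
  cases as with
  | nil =>
    simp only [Sum.inl.injEq] at h
    rw [← h]; exact length_valQuery_le G c q₀ u w hnN hx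
  | cons a as' =>
    dsimp only at h
    by_cases ha : decodeNat a = 0
    · rw [if_pos ha] at h; cases h
    · rw [if_neg ha] at h
      -- the scan got stuck: its pending query is a pivot query
      have key : ∀ (f j : ℕ) (bs : List (List Bool)) (q : List Bool), pivScan (randMaker G c q₀ u) (wmat (n + 1) w) f j bs = Sum.inl q →
          q.length ≤ (qB1p G c q₀).eval N := by
        intro f
        induction f with
        | zero => intro j bs q h; simp [pivScan] at h
        | succ f ih =>
          intro j bs q h
          rw [pivScan] at h
          by_cases hj : j < n + 1
          · rw [dif_pos hj] at h
            by_cases h1 : wmat (n + 1) w ⟨j, hj⟩ 0 ≠ 1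
            · rw [if_pos h1] at h; exact ih _ _ _ h
            · rw [if_neg h1] at h
              by_cases hn : n = 0
              · rw [if_pos hn] at h; cases h
              · rw [if_neg hn] at h
                cases bs with
                | nil =>
                  simp only [Sum.inl.injEq] at h
                  rw [← h]
                  exact length_pivQuery_le G c q₀ u w hj (by omega) hx
                | cons b bs' =>
                  dsimp only at h
                  by_cases hb : decodeNat b = 0
                  · rw [if_pos hb] at h; exact ih _ _ _ h
                  · rw [if_neg hb] at h; cases h
          · rw [dif_neg hj] at h; cases h
      rcases hps : pivScan (randMaker G c q₀ u) (wmat (n + 1) w) (n + 1) 0 as' with q' | ⟨piv, as''⟩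
      · rw [hps] at h
        simp only [Sum.map_inl, Sum.inl.injEq] at h
        rw [← h]; exact key _ _ _ _ hps
      · rw [hps] at h; cases h

/-- The code of a frame of dimension `≤ N` and first value of `≤ N + 1` bits, bounded by a polynomial in `N`. [folklore] -/
def frBp : Polynomial ℕ := 2 * ((X + 1) * (X + 1)) + 2 + (2 * (X + 1) + 2 + (2 * X + 2 + (X + 1)))

/-- `eval` of `frBp`. [folklore] -/
theorem frBp_eval (N : ℕ) : frBp.eval N = 2 * ((N + 1) * (N + 1)) + 2 + (2 * (N + 1) + 2 + (2 * N + 2 + (N + 1))) := by simp [frBp]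

/-- **The growth allowance of the descending loop**: a pending pre-phase query (doubled) plus a pushed frame. [folklore] -/
def DSp (G : ℕ) (c q₀ : Polynomial ℕ) : Polynomial ℕ := 2 * (qB1p G c q₀ + 1) + (4 * frBp + 4) + 8

/-- `eval` of `DSp`. [folklore] -/
theorem DSp_eval (G : ℕ) (c q₀ : Polynomial ℕ) (N : ℕ) : (DSp G c q₀).eval N = 2 * ((qB1p G c q₀).eval N + 1) + (4 * frBp.eval N + 4) + 8 := by
  simp [DSp]

/-- **The descending loop**: `|fstF z| + 1` clocked rounds of the capped step. [cite: AaronsonArkhipovToC2013, proof of Thm. 4.3 (pp. 176–177)] -/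
def descLoopF (G : ℕ) (c q₀ : Polynomial ℕ) : List Bool → List Bool := fun z =>
  (loopStep (rcapF (DSp G c q₀) (descStep G c q₀)))^[(X + 1 : Polynomial ℕ).eval (fstF z).length] z

/-- **`descLoopF G c q₀ ∈ FP`.** [cite: AroraBarak2009, §1.3 (bounded loops), §1.4.1] -/
theorem descLoopF_mem_FP (G : ℕ) (c q₀ : Polynomial ℕ) : descLoopF G c q₀ ∈ FP :=
  loopFn_rcapF_mem_FP (descStep_mem_FP G c q₀) (DSp G c q₀) (X + 1)

section DInvariant

variable (G : ℕ) (c q₀ : Polynomial ℕ) (u A : List Bool) (as₀ : List (List Bool))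

/-- **The invariant of the descending loop**: a descent state on a suffix of the initial transcript whose
current word `⟨w, 1ⁿ⟩` has `|w| = n²`, `n ≤ |inp|`, whose frames have dimensions `≤ |inp|` and first values
of `≤ |inp| + 1` bits, whose base value has `≤ 1` symbol, and whose status is descending, done, or pending
with a query of `≤ qB1p(|inp|)` symbols. [folklore] -/
def DInv (s : List Bool) : Prop :=
  ∃ (S : List Bool) (as : List (List Bool)) (n : ℕ) (w : List Bool) (fs : List WFrame) (V : List Bool),
    s = dEnc S as (cw n w) (frsEnc fs) V ∧ as <:+ as₀ ∧ w.length = n * n ∧ n ≤ (boolPair u A).length ∧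
    (∀ f ∈ fs, f.n + 1 ≤ (boolPair u A).length ∧ (encodeNat f.v0).length ≤ (boolPair u A).length + 1) ∧ V.length ≤ 1 ∧
    (S = [] ∨ S = [false] ∨ ∃ q, S = true :: q ∧ q.length ≤ (qB1p G c q₀).eval (boolPair u A).length)

variable {G c q₀ u A as₀}
variable (hA : ∀ a ∈ as₀, (encodeNat (decodeNat a)).length ≤ (boolPair u A).length + 1)

/-- The first value of a pivot found by the pre-phase is an answer of the transcript read by `decodeNat`. [folklore] -/
theorem levelPre_value_mem {mk : Maker} {n : ℕ} {X : Matrix (Fin (n + 1)) (Fin (n + 1)) ℤ} {as as' : List (List Bool)} {p : Fin (n + 1)} {v0 : ℕ}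
    (h : replay (levelPre mk X) as = Sum.inr (some (p, v0), as')) : (∃ a ∈ as, v0 = decodeNat a) ∧ as' <:+ as := by
  refine ⟨?_, isSuffix_of_replay_inr h⟩
  rw [replay_levelPre] at h
  cases as with
  | nil => cases h
  | cons a as₁ =>
    dsimp only at h
    by_cases ha : decodeNat a = 0
    · rw [if_pos ha] at h; simp at h
    · rw [if_neg ha] at h
      rcases hps : pivScan mk X (n + 1) 0 as₁ with q | ⟨piv, as''⟩
      · rw [hps] at h; cases h
      · rw [hps] at h
        simp only [Sum.map_inr, Sum.inr.injEq, Prod.mk.injEq] at h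
        obtain ⟨h1, -⟩ := h
        cases piv with
        | none => simp at h1
        | some p' =>
          simp only [Option.map_some, Option.some.injEq, Prod.mk.injEq] at h1
          exact ⟨a, List.mem_cons_self, h1.2.symm⟩

/-- An exit of the pre-phase leaves a suffix. [folklore] -/
theorem levelPre_none_suffix {mk : Maker} {n : ℕ} {X : Matrix (Fin (n + 1)) (Fin (n + 1)) ℤ} {as as' : List (List Bool)}
    (h : replay (levelPre mk X) as = Sum.inr (none, as')) : as' <:+ as := isSuffix_of_replay_inr h

include hA in
/-- **The descent step preserves the invariant.** [folklore] -/
theorem dinv_step (k : ℕ) (s : List Bool) (hs : DInv G c q₀ u A as₀ s) : DInv G c q₀ u A as₀ (descStep G c q₀ (boolPair (boolPair u A) (boolPair (encodeNat (k + 1)) s))) := by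
  obtain ⟨S, as, n, w, fs, V, rfl, hsuf, hw, hn, hfs, hV, hS⟩ := hs
  rcases hS with rfl | rfl | ⟨q, rfl, hq⟩
  · cases n with
    | zero =>
      rw [descStep_zero]
      exact ⟨[false], as, 0, w, fs, _, rfl, hsuf, hw, hn, hfs, by decide, Or.inr (Or.inl rfl)⟩
    | succ n =>
      rw [descStep_succ G c q₀ u A _ as hw hn fs V]
      rcases hro : replay (levelPre (randMaker G c q₀ u) (wmat (n + 1) w)) as with q | ⟨_ | ⟨p, v0⟩, as'⟩
      · refine ⟨_, [], n + 1, w, fs, V, rfl, List.nil_suffix, hw, hn, hfs, hV, Or.inr (Or.inr ⟨q, rfl, ?_⟩)⟩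
        exact length_levelPre_query_le G c q₀ u hn ((length_inX_le u).trans (by rw [length_boolPair]; omega)) hro
      · exact ⟨[false], as', n + 1, w, fs, [], rfl, (levelPre_none_suffix hro).trans hsuf, hw, hn, hfs, by simp, Or.inr (Or.inl rfl)⟩
      · obtain ⟨⟨a, ha, hva⟩, hsuf'⟩ := levelPre_value_mem hro
        refine ⟨[], as', n, _, ⟨n, w, hw, p, v0⟩ :: fs, V, rfl, hsuf'.trans hsuf, length_minorW_permW hw p, by omega, ?_, hV, Or.inl rfl⟩
        intro f hf
        rcases List.mem_cons.1 hf with rfl | hf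
        · exact ⟨hn, by rw [hva]; exact hA a (hsuf.subset ha)⟩
        · exact hfs f hf
  · rw [descStep_of_ne_nil G c q₀ u A _ (List.cons_ne_nil _ _)]
    exact ⟨[false], as, n, w, fs, V, rfl, hsuf, hw, hn, hfs, hV, Or.inr (Or.inl rfl)⟩
  · rw [descStep_of_ne_nil G c q₀ u A _ (List.cons_ne_nil _ _)]
    exact ⟨true :: q, as, n, w, fs, V, rfl, hsuf, hw, hn, hfs, hV, Or.inr (Or.inr ⟨q, rfl, hq⟩)⟩

include hA in
/-- **The descent step stays within the growth allowance** on states of the invariant. [folklore] -/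
theorem dinv_bound (k : ℕ) (s : List Bool) (hs : DInv G c q₀ u A as₀ s) :
    (descStep G c q₀ (boolPair (boolPair u A) (boolPair (encodeNat (k + 1)) s))).length ≤ s.length + (DSp G c q₀).eval (boolPair u A).length := by
  obtain ⟨S, as, n, w, fs, V, rfl, hsuf, hw, hn, hfs, hV, hS⟩ := hs
  rw [DSp_eval]
  rcases hS with rfl | rfl | ⟨q, rfl, hq⟩
  · cases n with
    | zero => rw [descStep_zero, length_dEnc, length_dEnc, show (encodeNat 1).length = 1 by decide]; simp; omega
    | succ n =>
      rw [descStep_succ G c q₀ u A _ as hw hn fs V]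
      rcases hro : replay (levelPre (randMaker G c q₀ u) (wmat (n + 1) w)) as with q | ⟨_ | ⟨p, v0⟩, as'⟩
      · have hq := length_levelPre_query_le G c q₀ u hn ((length_inX_le u).trans (by rw [length_boolPair]; omega)) hro
        rw [length_dEnc, length_dEnc]
        have hA0 : (ansEnc ([] : List (List Bool))).length ≤ (ansEnc as).length := length_ansEnc_le_of_suffix List.nil_suffix
        simp only [List.length_cons, List.length_nil]
        omega
      · rw [length_dEnc, length_dEnc]
        have h1 := length_ansEnc_le_of_suffix (levelPre_none_suffix hro)
        simp only [List.length_cons, List.length_nil]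
        omega
      · obtain ⟨⟨a, ha, hva⟩, hsuf'⟩ := levelPre_value_mem hro
        rw [length_dEnc, length_dEnc, frsEnc_cons, length_boolPair, length_cw, length_cw, length_minorW_permW hw p, length_frEnc]
        have h1 := length_ansEnc_le_of_suffix hsuf'
        have hv0 : (encodeNat v0).length ≤ (boolPair u A).length + 1 := by rw [hva]; exact hA a (hsuf.subset ha)
        have hp : (p : ℕ) ≤ n := Nat.lt_succ_iff.1 p.2
        have hfr : 2 * ((n + 1) * (n + 1)) + 2 + (2 * (n + 1) + 2 + (2 * (p : ℕ) + 2 + (encodeNat v0).length)) ≤ frBp.eval (boolPair u A).length := by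
          rw [frBp_eval]
          have : (n + 1) * (n + 1) ≤ ((boolPair u A).length + 1) * ((boolPair u A).length + 1) := Nat.mul_le_mul (by omega) (by omega)
          omega
        have hnn : n * n ≤ (n + 1) * (n + 1) := Nat.mul_le_mul (by omega) (by omega)
        simp only [List.length_nil]
        omega
  · rw [descStep_of_ne_nil G c q₀ u A _ (List.cons_ne_nil _ _)]; omega
  · rw [descStep_of_ne_nil G c q₀ u A _ (List.cons_ne_nil _ _)]; omega

end DInvariant

/-- **The descending loop from the top level** (input `⟨u, A⟩` whose transcript part holds `as`, `|w| = n²`,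
`n ≤ |inp|`): its final state codes `descFramesW (randMaker G c q₀ u) n w hw [] as` — pending, or done with
the frames and the base value. [cite: AaronsonArkhipovToC2013, proof of Thm. 4.3 (pp. 176–177)] -/
theorem descLoopF_apply (G : ℕ) (c q₀ : Polynomial ℕ) (u A : List Bool) (n : ℕ) (w : List Bool) (hw : w.length = n * n)
    (hnN : n ≤ (boolPair u A).length) (as : List (List Bool)) (hA : ∀ a ∈ as, (encodeNat (decodeNat a)).length ≤ (boolPair u A).length + 1) :
    match descFramesW (randMaker G c q₀ u) n w hw [] as with
    | Sum.inl q => ∃ rest, descLoopF G c q₀ (boolPair (boolPair u A) (boolPair (encodeNat (n + 1)) (dEnc [] as (cw n w) [] []))) =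
        boolPair (boolPair u A) (boolPair [] (boolPair (true :: q) rest))
    | Sum.inr (v, fs', as') => ∃ cur, descLoopF G c q₀ (boolPair (boolPair u A) (boolPair (encodeNat (n + 1)) (dEnc [] as (cw n w) [] []))) =
        boolPair (boolPair u A) (boolPair [] (dEnc [false] as' cur (frsEnc fs') (encodeNat v))) := by
  have hk : n + 1 ≤ (X + 1 : Polynomial ℕ).eval (fstF (boolPair (boolPair u A) (boolPair (encodeNat (n + 1)) (dEnc [] as (cw n w) [] [])))).length := by
    rw [fstF_boolPair]; simp only [Polynomial.eval_add, Polynomial.eval_X, Polynomial.eval_one]; omega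
  have hinit : DInv G c q₀ u A as (dEnc [] as (cw n w) (frsEnc []) []) :=
    ⟨[], as, n, w, [], [], rfl, List.suffix_refl _, hw, hnN, fun f hf => by simp at hf, by simp, Or.inl rfl⟩
  have hmodel := loopModel_descStep G c q₀ u A n w hw [] as [] (n + 1) le_rfl hnN
  have hcap : loopModel (rcapF (DSp G c q₀) (descStep G c q₀)) (boolPair u A) (n + 1) (dEnc [] as (cw n w) (frsEnc []) []) =
      loopModel (descStep G c q₀) (boolPair u A) (n + 1) (dEnc [] as (cw n w) (frsEnc []) []) :=
    loopModel_rcapF_of_invariant (DInv G c q₀ u A as) (dinv_step hA) (dinv_bound hA) _ _ hinit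
  rw [frsEnc_nil] at hcap hmodel
  rcases hdf : descFramesW (randMaker G c q₀ u) n w hw [] as with q | ⟨v, fs', as'⟩
  · rw [hdf] at hmodel
    obtain ⟨rest, hrest⟩ := hmodel
    exact ⟨rest, by rw [descLoopF, iterate_loopStep _ _ _ _ _ hk, hcap, hrest]⟩
  · rw [hdf] at hmodel
    obtain ⟨cur, hcur⟩ := hmodel
    exact ⟨cur, by rw [descLoopF, iterate_loopStep _ _ _ _ _ hk, hcap, hcur]⟩

/-! ### The ascending loop -/

/-- **The state of the ascending loop**: status, transcript, the value found so far, the frame stack. [folklore] -/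
def aEnc (S : List Bool) (as : List (List Bool)) (PY : ℕ) (frs : List Bool) : List Bool :=
  boolPair S (boolPair (ansEnc as) (boolPair (encodeNat PY) frs))

/-- Status of the ascent state. [folklore] -/
def aS : List Bool → List Bool := nthF 0
/-- Transcript. [folklore] -/
def aAS : List Bool → List Bool := nthF 1
/-- `bin P_Y`. [folklore] -/
def aPY : List Bool → List Bool := nthF 2
/-- Frame stack. [folklore] -/
def aFRS : List Bool → List Bool := sndPow 2

section AProj
variable (S : List Bool) (as : List (List Bool)) (PY : ℕ) (frs : List Bool)
/-- Value of `aS`. [folklore] -/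
@[simp] theorem aS_aEnc : aS (aEnc S as PY frs) = S := by simp [aS, aEnc]
/-- Value of `aAS`. [folklore] -/
@[simp] theorem aAS_aEnc : aAS (aEnc S as PY frs) = ansEnc as := by simp [aAS, aEnc, nthF]
/-- Value of `aPY`. [folklore] -/
@[simp] theorem aPY_aEnc : aPY (aEnc S as PY frs) = encodeNat PY := by simp [aPY, aEnc, nthF]
/-- Value of `aFRS`. [folklore] -/
@[simp] theorem aFRS_aEnc : aFRS (aEnc S as PY frs) = frs := by simp [aFRS, aEnc, sndPow]
end AProj

/-- The projections are in `FP`. [cite: AroraBarak2009, §1.3] -/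
theorem aproj_mem_FP : aS ∈ FP ∧ aAS ∈ FP ∧ aPY ∈ FP ∧ aFRS ∈ FP := ⟨nthF_mem_FP 0, nthF_mem_FP 1, nthF_mem_FP 2, sndPow_mem_FP 2⟩

/-- On the loop record: **the post-phase record** of the top frame `⟨wX, ⟨1^{m+1}, ⟨1ᵖ, bin v₀⟩⟩⟩` — the permuted
word `permWF`, the dimension and first value, `bin P_Y`, the transcript. [folklore] -/
def tRecF : List Bool → List Bool :=
  let f := fstF ∘ aFRS ∘ lSt
  fanoutFn (nthF 0) (fanoutFn (fanoutFn (permWF ∘ fanoutFn (fanoutFn (fstF ∘ f) (nthF 1 ∘ f)) (nthF 2 ∘ f)) (fanoutFn (nthF 1 ∘ f) (sndPow 2 ∘ f)))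
    (fanoutFn (aPY ∘ lSt) (aAS ∘ lSt)))

/-- Value of `tRecF` on a state with a top frame: the `tailRec` of the frame. [folklore] -/
theorem tRecF_rec (inp cnt S : List Bool) (as : List (List Bool)) (PY : ℕ) (f : WFrame) (fs : List WFrame) :
    tRecF (boolPair inp (boolPair cnt (aEnc S as PY (frsEnc (f :: fs))))) = tailRec inp f.n (permW (f.n + 1) f.w f.p) f.v0 PY as := by
  simp only [tRecF, fanoutFn_apply, Function.comp_apply, lSt_rec, aFRS_aEnc, aPY_aEnc, aAS_aEnc, frsEnc_cons, frEnc, fstF_boolPair, nthF,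
    sndPow, sndF_boolPair, permWF_apply f.w f.hw f.p.2, tailRec]

/-- `tRecF ∈ FP`. [cite: AroraBarak2009, §1.3] -/
theorem tRecF_mem_FP : tRecF ∈ FP := by
  obtain ⟨_, hASa, hPYa, hFRSa⟩ := aproj_mem_FP
  have hf : (fstF ∘ aFRS ∘ lSt) ∈ FP := comp_mem_FP fstF_mem_FP (comp_mem_FP hFRSa lSt_mem_FP)
  exact fanoutFn_mem_FP (nthF_mem_FP 0) (fanoutFn_mem_FP
    (fanoutFn_mem_FP (comp_mem_FP permWF_mem_FP (fanoutFn_mem_FP (fanoutFn_mem_FP (comp_mem_FP fstF_mem_FP hf) (comp_mem_FP (nthF_mem_FP 1) hf))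
      (comp_mem_FP (nthF_mem_FP 2) hf))) (fanoutFn_mem_FP (comp_mem_FP (nthF_mem_FP 1) hf) (comp_mem_FP (sndPow_mem_FP 2) hf)))
    (fanoutFn_mem_FP (comp_mem_FP hPYa lSt_mem_FP) (comp_mem_FP hASa lSt_mem_FP)))

/-- On `⟨loop record, tail output ⟨S', ⟨AS', R⟩⟩⟩`: **the new ascent state** — pending (status copied, stack
kept), else the returned value and the popped stack. [folklore] -/
def afterTailF : List Bool → List Bool :=
  let st := lSt ∘ fstF
  iteFn (isNilFn ∘ fstF ∘ sndF)
    (fanoutFn (fun _ => []) (fanoutFn (nthF 1 ∘ sndF) (fanoutFn (sndPow 1 ∘ sndF) (sndF ∘ aFRS ∘ st))))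
    (fanoutFn (fstF ∘ sndF) (fanoutFn (nthF 1 ∘ sndF) (fanoutFn (aPY ∘ st) (aFRS ∘ st))))

/-- `afterTailF ∈ FP`. [cite: AroraBarak2009, §1.3] -/
theorem afterTailF_mem_FP : afterTailF ∈ FP := by
  obtain ⟨_, _, hPYa, hFRSa⟩ := aproj_mem_FP
  have hst : (lSt ∘ fstF) ∈ FP := comp_mem_FP lSt_mem_FP fstF_mem_FP
  exact iteFn_mem_FP (comp_mem_FP isNilFn_mem_FP (comp_mem_FP fstF_mem_FP sndF_mem_FP))
    (fanoutFn_mem_FP (const_mem_FP _) (fanoutFn_mem_FP (comp_mem_FP (nthF_mem_FP 1) sndF_mem_FP)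
      (fanoutFn_mem_FP (comp_mem_FP (sndPow_mem_FP 1) sndF_mem_FP) (comp_mem_FP sndF_mem_FP (comp_mem_FP hFRSa hst)))))
    (fanoutFn_mem_FP (comp_mem_FP fstF_mem_FP sndF_mem_FP) (fanoutFn_mem_FP (comp_mem_FP (nthF_mem_FP 1) sndF_mem_FP)
      (fanoutFn_mem_FP (comp_mem_FP hPYa hst) (comp_mem_FP hFRSa hst))))

/-- **One level of the ascent**: idle unless running with a frame left; else the post-phase of the top frame. [cite: AaronsonArkhipovToC2013, proof of Thm. 4.3 (pp. 176–177)] -/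
def ascStep (G : ℕ) (c q₀ : Polynomial ℕ) : List Bool → List Bool :=
  iteFn (isNilFn ∘ aS ∘ lSt) (iteFn (isNilFn ∘ aFRS ∘ lSt) lSt (afterTailF ∘ fanoutFn id (tailF G c q₀ ∘ tRecF))) lSt

/-- `ascStep G c q₀ ∈ FP`. [cite: AroraBarak2009, §1.3] -/
theorem ascStep_mem_FP (G : ℕ) (c q₀ : Polynomial ℕ) : ascStep G c q₀ ∈ FP := by
  obtain ⟨hSa, _, _, hFRSa⟩ := aproj_mem_FP
  exact iteFn_mem_FP (comp_mem_FP isNilFn_mem_FP (comp_mem_FP hSa lSt_mem_FP))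
    (iteFn_mem_FP (comp_mem_FP isNilFn_mem_FP (comp_mem_FP hFRSa lSt_mem_FP)) lSt_mem_FP
      (comp_mem_FP afterTailF_mem_FP (fanoutFn_mem_FP OracleCompose.id_mem_FP (comp_mem_FP (tailF_mem_FP G c q₀) tRecF_mem_FP))))
    lSt_mem_FP

section AStep

variable (G : ℕ) (c q₀ : Polynomial ℕ) (u A cnt : List Bool)

/-- A state that is not running is fixed. [folklore] -/
theorem ascStep_of_ne_nil {S : List Bool} (hS : S ≠ []) (as : List (List Bool)) (PY : ℕ) (frs : List Bool) :
    ascStep G c q₀ (boolPair (boolPair u A) (boolPair cnt (aEnc S as PY frs))) = aEnc S as PY frs := by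
  rw [ascStep, iteFn_apply (b := false) (by simp [isNilFn, hS])]; simp

/-- No frame left: idle. [folklore] -/
theorem ascStep_nil (as : List (List Bool)) (PY : ℕ) : ascStep G c q₀ (boolPair (boolPair u A) (boolPair cnt (aEnc [] as PY []))) = aEnc [] as PY [] := by
  rw [ascStep, iteFn_apply (b := true) (by simp [isNilFn]), iteFn_apply (b := true) (by simp [isNilFn])]; simp

/-- **A frame left: its post-phase decides** (frame dimension `≤ |inp|`, its first value and the transcript
values of `≤ |inp| + 1` bits). [cite: AaronsonArkhipovToC2013, proof of Thm. 4.3 (pp. 176–177)] -/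
theorem ascStep_cons (as : List (List Bool)) (PY : ℕ) (f : WFrame) (fs : List WFrame) (hf : f.n + 1 ≤ (boolPair u A).length)
    (hv0 : (encodeNat f.v0).length ≤ (boolPair u A).length + 1) (hA : ∀ a ∈ as, (encodeNat (decodeNat a)).length ≤ (boolPair u A).length + 1) :
    ascStep G c q₀ (boolPair (boolPair u A) (boolPair cnt (aEnc [] as PY (frsEnc (f :: fs))))) =
      match replay (levelPost (randMaker G c q₀ u) G (wmat (f.n + 1) f.w) f.p f.v0 PY) as with
      | Sum.inr (v, as') => aEnc [] as' v (frsEnc fs)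
      | Sum.inl q => aEnc (true :: q) [] PY (frsEnc (f :: fs)) := by
  rw [ascStep, iteFn_apply (b := true) (by simp [isNilFn]), iteFn_apply (b := false) (by simp [isNilFn, Literature.Computability.Cryptography.QCircuit.boolPair_ne_nil])]
  simp only [if_true, Bool.false_eq_true, if_false, Function.comp_apply, fanoutFn_apply, id, tRecF_rec, tailF_levelPost G c q₀ u A f.n f.hw f.p hf hv0 PY hA]
  rcases replay (levelPost (randMaker G c q₀ u) G (wmat (f.n + 1) f.w) f.p f.v0 PY) as with q | ⟨v, as'⟩
  · rw [afterTailF, iteFn_apply (b := false) (by simp [isNilFn])]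
    simp only [Bool.false_eq_true, if_false, fanoutFn_apply, Function.comp_apply, fstF_boolPair, sndF_boolPair, lSt_rec, aPY_aEnc, aFRS_aEnc,
      nthF, sndPow]
    rfl
  · rw [afterTailF, iteFn_apply (b := true) (by simp [isNilFn])]
    simp only [if_true, fanoutFn_apply, Function.comp_apply, fstF_boolPair, sndF_boolPair, lSt_rec, aPY_aEnc, aFRS_aEnc, nthF, sndPow,
      frsEnc_cons]
    rfl

end AStep

/-- Any state whose status field is nonempty is fixed (general form, for pending states of any shape). [folklore] -/
theorem ascStep_idle (G : ℕ) (c q₀ : Polynomial ℕ) (inp cnt : List Bool) {S : List Bool} (hS : S ≠ []) (rest : List Bool) :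
    ascStep G c q₀ (boolPair inp (boolPair cnt (boolPair S rest))) = boolPair S rest := by
  rw [ascStep, iteFn_apply (b := false) (by simp [isNilFn, aS, lSt, sndPow, hS])]; simp [lSt, sndPow]

/-- States that are not running are fixed by the rounds. [folklore] -/
theorem loopModel_ascStep_of_ne_nil (G : ℕ) (c q₀ : Polynomial ℕ) (u A : List Bool) {S : List Bool} (hS : S ≠ []) (as : List (List Bool))
    (PY : ℕ) (frs : List Bool) : ∀ k : ℕ, loopModel (ascStep G c q₀) (boolPair u A) k (aEnc S as PY frs) = aEnc S as PY frs
  | 0 => rfl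
  | k + 1 => by rw [loopModel, ascStep_of_ne_nil G c q₀ u A _ hS, loopModel_ascStep_of_ne_nil G c q₀ u A hS as PY frs k]

/-- Without frames every round idles. [folklore] -/
theorem loopModel_ascStep_nil (G : ℕ) (c q₀ : Polynomial ℕ) (u A : List Bool) (as : List (List Bool)) (PY : ℕ) :
    ∀ k : ℕ, loopModel (ascStep G c q₀) (boolPair u A) k (aEnc [] as PY []) = aEnc [] as PY []
  | 0 => rfl
  | k + 1 => by rw [loopModel, ascStep_nil, loopModel_ascStep_nil G c q₀ u A as PY k]

/-- **The ascending rounds follow `ascend`** (at least `|frames|` rounds): the final value with the leftover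
transcript, or a pending state. [cite: AaronsonArkhipovToC2013, proof of Thm. 4.3 (pp. 176–177)] -/
theorem loopModel_ascStep (G : ℕ) (c q₀ : Polynomial ℕ) (u A : List Bool) :
    ∀ (fs : List WFrame) (as : List (List Bool)) (PY k : ℕ), fs.length ≤ k →
      (∀ f ∈ fs, f.n + 1 ≤ (boolPair u A).length ∧ (encodeNat f.v0).length ≤ (boolPair u A).length + 1) →
      (∀ a ∈ as, (encodeNat (decodeNat a)).length ≤ (boolPair u A).length + 1) →
      match ascend (randMaker G c q₀ u) G PY (fs.map WFrame.toFrame) as with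
      | Sum.inr (v, as') => loopModel (ascStep G c q₀) (boolPair u A) k (aEnc [] as PY (frsEnc fs)) = aEnc [] as' v []
      | Sum.inl q => ∃ rest, loopModel (ascStep G c q₀) (boolPair u A) k (aEnc [] as PY (frsEnc fs)) = boolPair (true :: q) rest
  | [], as, PY, k, _, _, _ => by
    show loopModel (ascStep G c q₀) (boolPair u A) k (aEnc [] as PY (frsEnc [])) = aEnc [] as PY []
    rw [frsEnc_nil, loopModel_ascStep_nil]
  | f :: fs, as, PY, k, hk, hfs, hA => by
    obtain ⟨k, rfl⟩ : ∃ k', k = k' + 1 := ⟨k - 1, by simp at hk; omega⟩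
    rw [List.map_cons, ascend]
    show (match (match replay (levelPost (randMaker G c q₀ u) G (wmat (f.n + 1) f.w) f.p f.v0 PY) as with
        | Sum.inl q => Sum.inl q | Sum.inr (v, as') => ascend (randMaker G c q₀ u) G v (fs.map WFrame.toFrame) as') with
      | Sum.inr (v, as') => loopModel (ascStep G c q₀) (boolPair u A) (k + 1) (aEnc [] as PY (frsEnc (f :: fs))) = aEnc [] as' v []
      | Sum.inl q => ∃ rest, loopModel (ascStep G c q₀) (boolPair u A) (k + 1) (aEnc [] as PY (frsEnc (f :: fs))) = boolPair (true :: q) rest)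
    have hstep := ascStep_cons G c q₀ u A (encodeNat (k + 1)) as PY f fs (hfs f List.mem_cons_self).1 (hfs f List.mem_cons_self).2 hA
    rcases hro : replay (levelPost (randMaker G c q₀ u) G (wmat (f.n + 1) f.w) f.p f.v0 PY) as with q | ⟨v, as'⟩
    · rw [hro] at hstep
      refine ⟨boolPair (ansEnc []) (boolPair (encodeNat PY) (frsEnc (f :: fs))), ?_⟩
      rw [loopModel, hstep]
      exact loopModel_ascStep_of_ne_nil G c q₀ u A (List.cons_ne_nil _ _) _ _ _ _
    · rw [hro] at hstep
      dsimp only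
      have hsuf : as' <:+ as := isSuffix_of_replay_inr hro
      have ih := loopModel_ascStep G c q₀ u A fs as' v k (by simp at hk; omega) (fun f' hf' => hfs f' (List.mem_cons_of_mem _ hf'))
        (fun a ha => hA a (hsuf.subset ha))
      rw [loopModel, hstep]
      exact ih

/-! ### Sizes of the ascent and the capped ascending loop -/

/-- `pyE` as a polynomial in `N = |input|`. [folklore] -/
def pyEp (G : ℕ) : Polynomial ℕ := RBp G + (C G + 1 + (X + 1) ^ 2) + (X + 1) ^ 2 + 1

/-- `eval` of `pyEp`. [folklore] -/
theorem pyEp_eval (G N : ℕ) : (pyEp G).eval N = pyE G N := by simp [pyEp, pyE]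

/-- **The growth allowance of the ascending loop**: a pending query (doubled) plus a returned value. [folklore] -/
def ASp (G : ℕ) (c q₀ : Polynomial ℕ) : Polynomial ℕ := 2 * (qBp G c q₀ + qB1p G c q₀ + 1) + 2 * pyEp G + 8

/-- `eval` of `ASp`. [folklore] -/
theorem ASp_eval (G : ℕ) (c q₀ : Polynomial ℕ) (N : ℕ) :
    (ASp G c q₀).eval N = 2 * ((qBp G c q₀).eval N + (qB1p G c q₀).eval N + 1) + 2 * (pyEp G).eval N + 8 := by
  simp [ASp]

/-- **A pending query of the post-phase is polynomially bounded**: it is the grid query of the stuck round,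
whose state satisfies `USz`. [cite: AaronsonArkhipovToC2013, proof of Thm. 4.3 (p. 177) with Def. 2.4 (p. 163)] -/
theorem length_levelPost_query_le (G : ℕ) (c q₀ : Polynomial ℕ) (u : List Bool) {m N : ℕ} {w : List Bool} (hw : w.length = (m + 1) * (m + 1))
    (p : Fin (m + 1)) (v0 PY : ℕ) (hmN : m + 1 ≤ N) (hx : (inX u).length ≤ N) {as : List (List Bool)} {q : List Bool}
    (h : replay (levelPost (randMaker G c q₀ u) G (wmat (m + 1) w) p v0 PY) as = Sum.inl q) : q.length ≤ (qBp G c q₀).eval N := by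
  rw [replay_levelPost] at h
  by_cases hcl : PY = 0 ∨ m.factorial < PY
  · rw [if_pos hcl] at h; cases h
  · rw [if_neg hcl] at h
    have hPY0 : 0 < PY := Nat.pos_of_ne_zero fun h0 => hcl (Or.inl h0)
    have hPYle : PY ≤ (m + 1).factorial := (not_lt.1 fun h1 => hcl (Or.inr h1)).trans (Nat.factorial_le (Nat.le_succ m))
    have htop : topMatrix (wmat (m + 1) w) p = wmat (m + 1) (permW (m + 1) w p) := (wmat_permW w hw p).symm
    rw [htop] at h
    -- the stuck round of the rounds
    have key : ∀ (k t : ℕ) (st : ℕ × ℚ × ℕ) (bs : List (List Bool)), USz G m PY t st → st.1 = t → t + k ≤ rounds G m →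
        replay (iterM (searchRound (randMaker G c q₀ u) G (m + 1) (wmat (m + 1) (permW (m + 1) w p)) PY) k st) bs = Sum.inl q →
        q.length ≤ (qBp G c q₀).eval N := by
      intro k
      induction k with
      | zero => intro t st bs _ _ _ h; rw [replay_iterM_zero] at h; cases h
      | succ k ih =>
        intro t st bs husz hst htk h
        rw [replay_iterM_succ] at h
        rcases hro : replay (searchRound (randMaker G c q₀ u) G (m + 1) (wmat (m + 1) (permW (m + 1) w p)) PY st) bs with q' | ⟨st', bs'⟩
        · rw [hro] at h
          simp only [Sum.inl.injEq] at h
          subst h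
          have hcl := hro
          rw [replay_searchRound] at hcl
          by_cases hv : st.2.2 = 0
          · rw [if_pos hv] at hcl; cases hcl
          · rw [if_neg hv] at hcl
            by_cases hl : 3 * G + 1 ≤ bs.length
            · rw [if_pos hl] at hcl; cases hcl
            · rw [if_neg hl] at hcl
              simp only [Sum.inl.injEq] at hcl
              rw [← hcl]
              exact length_gridQuery_le_qBp G c q₀ _ (by rw [hst]; exact husz) (by omega) hPY0 hPYle (by omega) hmN hx
        · rw [hro] at h
          obtain ⟨husz', ht', -, -⟩ := searchRound_usz hPY0 _ (m + 1) _ husz hro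
          exact ih (t + 1) st' bs' husz' (by omega) (by omega) h
    rcases hit : replay (iterM (searchRound (randMaker G c q₀ u) G (m + 1) (wmat (m + 1) (permW (m + 1) w p)) PY) (rounds G m) (0, 0, v0)) as with q' | ⟨st, as'⟩
    · rw [hit] at h
      simp only [Sum.inl.injEq] at h
      subst h
      exact key (rounds G m) 0 (0, 0, v0) as (usz_init G m PY v0) rfl (by omega) hit
    · rw [hit] at h; cases h

/-- Length of an ascent state. [folklore] -/
theorem length_aEnc (S : List Bool) (as : List (List Bool)) (PY : ℕ) (frs : List Bool) :
    (aEnc S as PY frs).length = 2 * S.length + 2 + (2 * (ansEnc as).length + 2 + (2 * (encodeNat PY).length + 2 + frs.length)) := by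
  simp only [aEnc, length_boolPair]

/-- **The ascending loop**: `|fstF z| + 1` clocked rounds of the capped step. [cite: AaronsonArkhipovToC2013, proof of Thm. 4.3 (pp. 176–177)] -/
def ascLoopF (G : ℕ) (c q₀ : Polynomial ℕ) : List Bool → List Bool := fun z =>
  (loopStep (rcapF (ASp G c q₀) (ascStep G c q₀)))^[(X + 1 : Polynomial ℕ).eval (fstF z).length] z

/-- **`ascLoopF G c q₀ ∈ FP`.** [cite: AroraBarak2009, §1.3 (bounded loops), §1.4.1] -/
theorem ascLoopF_mem_FP (G : ℕ) (c q₀ : Polynomial ℕ) : ascLoopF G c q₀ ∈ FP :=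
  loopFn_rcapF_mem_FP (ascStep_mem_FP G c q₀) (ASp G c q₀) (X + 1)

section AInvariant

variable (G : ℕ) (c q₀ : Polynomial ℕ) (u A : List Bool) (as₀ : List (List Bool))

/-- **The invariant of the ascending loop**: an ascent state on a suffix of the initial transcript, value of
`≤ pyE(|inp|)` bits (or the base value), frames of dimension `≤ |inp|` with small first values, status
running or pending with a query of `≤ qBp(|inp|)` symbols. [folklore] -/
def AInv (s : List Bool) : Prop :=
  ∃ (S : List Bool) (as : List (List Bool)) (PY : ℕ) (fs : List WFrame), s = aEnc S as PY (frsEnc fs) ∧ as <:+ as₀ ∧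
    (encodeNat PY).length ≤ pyE G (boolPair u A).length ∧
    (∀ f ∈ fs, f.n + 1 ≤ (boolPair u A).length ∧ (encodeNat f.v0).length ≤ (boolPair u A).length + 1) ∧
    (S = [] ∨ ∃ q, S = true :: q ∧ q.length ≤ (qBp G c q₀).eval (boolPair u A).length)

variable {G c q₀ u A as₀}
variable (hA : ∀ a ∈ as₀, (encodeNat (decodeNat a)).length ≤ (boolPair u A).length + 1)

include hA in
/-- **The ascent step preserves the invariant.** [folklore] -/
theorem ainv_step (k : ℕ) (s : List Bool) (hs : AInv G c q₀ u A as₀ s) : AInv G c q₀ u A as₀ (ascStep G c q₀ (boolPair (boolPair u A) (boolPair (encodeNat (k + 1)) s))) := by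
  obtain ⟨S, as, PY, fs, rfl, hsuf, hPY, hfs, hS⟩ := hs
  rcases hS with rfl | ⟨q, rfl, hq⟩
  · cases fs with
    | nil => rw [frsEnc_nil, ascStep_nil]; exact ⟨[], as, PY, [], rfl, hsuf, hPY, by simp, Or.inl rfl⟩
    | cons f fs =>
      have hf := hfs f List.mem_cons_self
      rw [ascStep_cons G c q₀ u A _ as PY f fs hf.1 hf.2 (fun a ha => hA a (hsuf.subset ha))]
      rcases hro : replay (levelPost (randMaker G c q₀ u) G (wmat (f.n + 1) f.w) f.p f.v0 PY) as with q | ⟨v, as'⟩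
      · refine ⟨_, [], PY, f :: fs, rfl, List.nil_suffix, hPY, hfs, Or.inr ⟨q, rfl, ?_⟩⟩
        exact length_levelPost_query_le G c q₀ u f.hw f.p f.v0 PY hf.1 ((length_inX_le u).trans (by rw [length_boolPair]; omega)) hro
      · have hsuf' : as' <:+ as := isSuffix_of_replay_inr hro
        refine ⟨[], as', v, fs, rfl, hsuf'.trans hsuf, ?_, fun f' hf' => hfs f' (List.mem_cons_of_mem _ hf'), Or.inl rfl⟩
        exact (length_encodeNat_le_of_lt_two_pow (levelPost_value_lt _ G _ f.p f.v0 PY hro)).trans (pyE_mono (by omega))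
  · rw [ascStep_of_ne_nil G c q₀ u A _ (List.cons_ne_nil _ _)]
    exact ⟨true :: q, as, PY, fs, rfl, hsuf, hPY, hfs, Or.inr ⟨q, rfl, hq⟩⟩

include hA in
/-- **The ascent step stays within the growth allowance** on states of the invariant. [folklore] -/
theorem ainv_bound (k : ℕ) (s : List Bool) (hs : AInv G c q₀ u A as₀ s) :
    (ascStep G c q₀ (boolPair (boolPair u A) (boolPair (encodeNat (k + 1)) s))).length ≤ s.length + (ASp G c q₀).eval (boolPair u A).length := by
  obtain ⟨S, as, PY, fs, rfl, hsuf, hPY, hfs, hS⟩ := hs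
  rw [ASp_eval, pyEp_eval]
  rcases hS with rfl | ⟨q, rfl, hq⟩
  · cases fs with
    | nil => rw [frsEnc_nil, ascStep_nil]; omega
    | cons f fs =>
      have hf := hfs f List.mem_cons_self
      rw [ascStep_cons G c q₀ u A _ as PY f fs hf.1 hf.2 (fun a ha => hA a (hsuf.subset ha))]
      rcases hro : replay (levelPost (randMaker G c q₀ u) G (wmat (f.n + 1) f.w) f.p f.v0 PY) as with q | ⟨v, as'⟩
      · have hq := length_levelPost_query_le G c q₀ u f.hw f.p f.v0 PY hf.1 ((length_inX_le u).trans (by rw [length_boolPair]; omega)) hro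
        rw [length_aEnc, length_aEnc]
        have hA0 : (ansEnc ([] : List (List Bool))).length ≤ (ansEnc as).length := length_ansEnc_le_of_suffix List.nil_suffix
        simp only [List.length_cons, List.length_nil]
        omega
      · have hsuf' : as' <:+ as := isSuffix_of_replay_inr hro
        have hv := (length_encodeNat_le_of_lt_two_pow (levelPost_value_lt _ G _ f.p f.v0 PY hro)).trans (pyE_mono (G := G) (by omega : f.n ≤ (boolPair u A).length))
        rw [length_aEnc, length_aEnc, frsEnc_cons, length_boolPair]
        have h1 := length_ansEnc_le_of_suffix hsuf'
        simp only [List.length_nil]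
        omega
  · rw [ascStep_of_ne_nil G c q₀ u A _ (List.cons_ne_nil _ _)]; omega

end AInvariant

/-- **The ascending loop** (input `⟨u, A⟩`, frames of dimension `≤ n ≤ |inp|` with small first values,
transcript values of `≤ |inp| + 1` bits, base value `P_Y ≤ 1`, at least `|fs|` rounds via `n + 1 ≥ |fs|`):
its final state codes `ascend (randMaker G c q₀ u) G P_Y (fs.map toFrame) as`. [cite: AaronsonArkhipovToC2013, proof of Thm. 4.3 (pp. 176–177)] -/
theorem ascLoopF_apply (G : ℕ) (c q₀ : Polynomial ℕ) (u A : List Bool) (n : ℕ) (hnN : n ≤ (boolPair u A).length) (fs : List WFrame)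
    (hlen : fs.length ≤ n + 1) (hfs : ∀ f ∈ fs, f.n + 1 ≤ (boolPair u A).length ∧ (encodeNat f.v0).length ≤ (boolPair u A).length + 1)
    {PY : ℕ} (hPY : PY ≤ 1) (as : List (List Bool)) (hA : ∀ a ∈ as, (encodeNat (decodeNat a)).length ≤ (boolPair u A).length + 1) :
    match ascend (randMaker G c q₀ u) G PY (fs.map WFrame.toFrame) as with
    | Sum.inr (v, as') => ascLoopF G c q₀ (boolPair (boolPair u A) (boolPair (encodeNat (n + 1)) (aEnc [] as PY (frsEnc fs)))) =
        boolPair (boolPair u A) (boolPair [] (aEnc [] as' v []))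
    | Sum.inl q => ∃ rest, ascLoopF G c q₀ (boolPair (boolPair u A) (boolPair (encodeNat (n + 1)) (aEnc [] as PY (frsEnc fs)))) =
        boolPair (boolPair u A) (boolPair [] (boolPair (true :: q) rest)) := by
  have hk : n + 1 ≤ (X + 1 : Polynomial ℕ).eval (fstF (boolPair (boolPair u A) (boolPair (encodeNat (n + 1)) (aEnc [] as PY (frsEnc fs))))).length := by
    rw [fstF_boolPair]; simp only [Polynomial.eval_add, Polynomial.eval_X, Polynomial.eval_one]; omega
  have hPYb : (encodeNat PY).length ≤ pyE G (boolPair u A).length := by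
    have : (encodeNat PY).length ≤ 1 := by interval_cases PY <;> decide
    exact this.trans (by unfold pyE; omega)
  have hinit : AInv G c q₀ u A as (aEnc [] as PY (frsEnc fs)) := ⟨[], as, PY, fs, rfl, List.suffix_refl _, hPYb, hfs, Or.inl rfl⟩
  have hcap := loopModel_rcapF_of_invariant (AInv G c q₀ u A as) (ainv_step hA) (ainv_bound hA) (n + 1) _ hinit
  have hmodel := loopModel_ascStep G c q₀ u A fs as PY (n + 1) hlen hfs hA
  rcases had : ascend (randMaker G c q₀ u) G PY (fs.map WFrame.toFrame) as with q | ⟨v, as'⟩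
  · rw [had] at hmodel
    obtain ⟨rest, hrest⟩ := hmodel
    exact ⟨rest, by rw [ascLoopF, iterate_loopStep _ _ _ _ _ hk, hcap, hrest]⟩
  · rw [had] at hmodel
    rw [ascLoopF, iterate_loopStep _ _ _ _ _ hk, hcap, hmodel]

/-- The capped ascent fixes every state whose status field is nonempty. [folklore] -/
theorem loopModel_rcapF_ascStep_idle (G : ℕ) (c q₀ : Polynomial ℕ) (inp : List Bool) {S : List Bool} (hS : S ≠ []) (rest : List Bool) :
    ∀ k : ℕ, loopModel (rcapF (ASp G c q₀) (ascStep G c q₀)) inp k (boolPair S rest) = boolPair S rest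
  | 0 => rfl
  | k + 1 => by
    rw [loopModel, rcapF_record (by rw [ascStep_idle G c q₀ _ _ hS]; omega), ascStep_idle G c q₀ _ _ hS]
    exact loopModel_rcapF_ascStep_idle G c q₀ inp hS rest k

/-- **The ascending loop on a pending state idles.** [folklore] -/
theorem ascLoopF_pending (G : ℕ) (c q₀ : Polynomial ℕ) (inp : List Bool) {k : ℕ} (hk : k ≤ inp.length + 1) (q rest : List Bool) :
    ascLoopF G c q₀ (boolPair inp (boolPair (encodeNat k) (boolPair (true :: q) rest))) = boolPair inp (boolPair [] (boolPair (true :: q) rest)) := by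
  have hk' : k ≤ (X + 1 : Polynomial ℕ).eval (fstF (boolPair inp (boolPair (encodeNat k) (boolPair (true :: q) rest)))).length := by
    rw [fstF_boolPair]; simp only [Polynomial.eval_add, Polynomial.eval_X, Polynomial.eval_one]; omega
  rw [ascLoopF, iterate_loopStep _ _ _ _ _ hk', loopModel_rcapF_ascStep_idle G c q₀ inp (List.cons_ne_nil _ _)]

end PerSearch

end Literature.Computability.QuantumComplexity

end


/-!
## Part II — the step machine and the discharge

Aaronson–Arkhipov, *The computational complexity of linear optics*, Theory of Computing 9 (2013),
Thm. 4.3 (proof, pp. 176–177): "we will show how to compute `Per(X)` exactly, in polynomial time and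
using `O(g n² log n)` adaptive queries to `𝒪`". The tree records the machine-level content of "in
polynomial time" as the named fact `PerSearch.randSearchAlg_isPolyTime` (`PermanentSearchRandom.lean`):
the transcript step function of the randomised search `randSearchAlg G c q₀ = toOracleAlg (randComp G c q₀)`
— on the coded pair `⟨u, listBool as⟩` of the decorated query and the answers so far, the next query or
the output — is polynomial-time computable. Its value is `toStep_randComp` (`PermanentSearchReplay.lean`:
decode the matrix, the two-loop model `descend (randMaker …)`, the clamped binary answer). This file
assembles the machine from the bricks of `PerSearchScanBrick.lean`, `PerSearchTailBrick.lean` and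
Part I:

* `stepStr G c q₀` — test the matrix code (`chkDim`, `chkRows`, `chk01` of `PermanentCodeTranscoder.lean`;
  otherwise the answer `ε`), lay out the initial descent record (`toPlainFn` gives the row-major word,
  the transcript part of the input IS the transcript code `ansEnc`), run `descLoopF` then `ascLoopF`,
  and read out: pending `0 q`, or `1 bin (min v n!)`; `stepStr_mem_FP`;
* `stepStr_apply` — it computes the `sumBool` code of `toStep (randComp G c q₀ u) as`
  (`descend_eq_descFrames`, `descFrames_wmat`, `descLoopF_apply`, `ascLoopF_apply`, `wmat_plainWord`);
* **`randSearchAlg_isPolyTime_holds : PerSearch.randSearchAlg_isPolyTime`.**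

## References

* S. Aaronson, A. Arkhipov, *The computational complexity of linear optics*, Theory of Computing 9
  (2013), Thm. 4.3 and its proof (pp. 176–177); Thm. 1.1 (p. 149).
* S. Arora, B. Barak, *Computational Complexity: A Modern Approach*, CUP 2009, §1.3 (closure of
  polynomial time under composition and bounded loops), §3.4 (oracle machines).
-/

noncomputable section

namespace Literature.Computability.QuantumComplexity

open _root_.Computability Complexity Complexity.Brick Complexity.Plumb Complexity.OracleComp Matrix
  Literature.Computability.AlgebraicComplexity Polynomial

namespace PerSearch

/-! ### The machine input -/

/-- **The transcript part of the machine input is the transcript code**: `listBool as = ansEnc as`. [folklore] -/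
theorem listBool_encode_eq_ansEnc (as : List (List Bool)) : (encodingList Bool).listBool.encode as = ansEnc as := by
  rw [ansEnc, encList_eq_foldr]
  change boolPair (unaryEncodeNat as.length) (as.foldr (fun a acc => boolPair ((encodingList Bool).encode a) acc) []) = _
  rw [OracleCompose.unaryEncodeNat_eq_replicate]
  rfl

/-- The answers of the transcript, read by `decodeNat` and written in binary, are short. [folklore] -/
theorem length_answers_le (u : List Bool) (as : List (List Bool)) :
    ∀ a ∈ as, (encodeNat (decodeNat a)).length ≤ (boolPair u (ansEnc as)).length + 1 := fun a ha => by
  rw [← canonF_eq_encodeNat_decodeNat]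
  refine (length_canonF_le a).trans ?_
  have h1 := length_le_of_mem_encList ha
  rw [length_boolPair, length_ansEnc]
  omega

/-- On the machine input: the matrix code `y = inY u`. [folklore] -/
def yF : List Bool → List Bool := sndF ∘ sndF ∘ fstF
/-- On the machine input: the row fuel field of the matrix code (a string of length `codeFuel y`). [folklore] -/
def fuelF : List Bool → List Bool := fstF ∘ sndF ∘ yF

/-- Value of `yF`. [folklore] -/
@[simp] theorem yF_apply (u A : List Bool) : yF (boolPair u A) = inY u := by simp [yF]; rfl
/-- Value of `fuelF`: a string of length `codeFuel (inY u)`. [folklore] -/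
theorem length_fuelF (u A : List Bool) : (fuelF (boolPair u A)).length = codeFuel (inY u) := by simp [fuelF, codeFuel]; rfl

/-- `yF ∈ FP`, `fuelF ∈ FP`. [cite: AroraBarak2009, §1.3] -/
theorem yF_fuelF_mem_FP : yF ∈ FP ∧ fuelF ∈ FP :=
  ⟨comp_mem_FP sndF_mem_FP (comp_mem_FP sndF_mem_FP fstF_mem_FP),
    comp_mem_FP fstF_mem_FP (comp_mem_FP sndF_mem_FP (comp_mem_FP sndF_mem_FP (comp_mem_FP sndF_mem_FP fstF_mem_FP)))⟩

/-- **The `0/1`-code test** `[IsZeroOneCode (inY u)]` (the three tests of the transcoder). [folklore] -/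
def code01T : List Bool → List Bool := andFn chkDim (andFn chkRows chk01) ∘ yF

/-- Value of the test. [folklore] -/
theorem code01T_apply (u A : List Bool) : code01T (boolPair u A) = [decide (IsZeroOneCode (inY u))] := by
  rw [code01T, Function.comp_apply, yF_apply,
    andFn_apply (chkDim_apply _) (andFn_apply (chkRows_apply _) (chk01_apply _)), ← Bool.decide_and, ← Bool.decide_and]
  congr 1
  apply Bool.decide_congr
  unfold IsZeroOneCode CodeOK
  constructor
  · rintro ⟨h1, h2, h3⟩
    rw [← h1] at *
    exact ⟨⟨h1.symm, h2⟩, h3⟩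
  · rintro ⟨⟨h1, h2⟩, h3⟩
    rw [h1] at *
    exact ⟨h1.symm ▸ rfl, h2, h3⟩

/-- `code01T ∈ FP`. [cite: AroraBarak2009, §1.3] -/
theorem code01T_mem_FP : code01T ∈ FP :=
  comp_mem_FP (andFn_mem_FP chkDim_mem_FP (andFn_mem_FP chkRows_mem_FP chk01_mem_FP)) yF_fuelF_mem_FP.1

/-! ### The initial records and the read-out -/

/-- **The initial record of the descending loop**: `⟨inp, ⟨bin (n+1), dEnc ε as ⟨word, 1ⁿ⟩ ε ε⟩⟩`,
`n = codeFuel y` (`= codeDim y` on well-formed codes), the word by `toPlainFn`. [folklore] -/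
def descInitF : List Bool → List Bool :=
  fanoutFn id (fanoutFn (addFn ∘ fanoutFn (lenBinF ∘ fuelF) fun _ => [true])
    (fanoutFn (fun _ => []) (fanoutFn sndF (fanoutFn (fanoutFn (toPlainFn ∘ yF) (polyFn X ∘ fuelF)) (fanoutFn (fun _ => []) fun _ => [])))))

/-- Value of the initial descent record on a `0/1` code. [folklore] -/
theorem descInitF_apply (u : List Bool) (as : List (List Bool)) (h : IsZeroOneCode (inY u)) :
    descInitF (boolPair u (ansEnc as)) =
      boolPair (boolPair u (ansEnc as)) (boolPair (encodeNat (codeDim (inY u) + 1))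
        (dEnc [] as (cw (codeDim (inY u)) (plainWord (inY u))) [] [])) := by
  have hf := length_fuelF u (ansEnc as)
  rw [h.1.1] at hf
  simp only [descInitF, fanoutFn_apply, Function.comp_apply, id, sndF_boolPair, lenBinF_apply, hf, addFn_boolPair, bitsToNat_encodeNat,
    polyFn_apply, Polynomial.eval_X, yF_apply, toPlainFn_apply, toPlainSpec, if_pos h, dEnc, cw]
  rw [show bitsToNat [true] = 1 by simp [bitsToNat]]

/-- `descInitF ∈ FP`. [cite: AroraBarak2009, §1.3] -/
theorem descInitF_mem_FP : descInitF ∈ FP := by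
  obtain ⟨hy, hfu⟩ := yF_fuelF_mem_FP
  exact fanoutFn_mem_FP OracleCompose.id_mem_FP (fanoutFn_mem_FP (comp_mem_FP addFn_mem_FP (fanoutFn_mem_FP (comp_mem_FP lenBinF_mem_FP hfu) (const_mem_FP _)))
    (fanoutFn_mem_FP (const_mem_FP _) (fanoutFn_mem_FP sndF_mem_FP (fanoutFn_mem_FP (fanoutFn_mem_FP (comp_mem_FP toPlainFn_mem_FP hy)
      (comp_mem_FP (polyFn_mem_FP _) hfu)) (fanoutFn_mem_FP (const_mem_FP _) (const_mem_FP _))))))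

/-- On the output `⟨inp, ⟨ε, descent state⟩⟩` of the descending loop: **the initial record of the ascending
loop** — counter `bin (n+1)` again, status (`0` done ↦ running `ε`, pending kept), transcript, value, frames. [folklore] -/
def ascInitF : List Bool → List Bool :=
  let st := sndPow 1
  fanoutFn (nthF 0) (fanoutFn (addFn ∘ fanoutFn (lenBinF ∘ fuelF ∘ nthF 0) fun _ => [true])
    (fanoutFn (iteFn (eqPairFn ∘ fanoutFn (dS ∘ st) fun _ => [false]) (fun _ => []) (dS ∘ st))
      (fanoutFn (dAS ∘ st) (fanoutFn (dV ∘ st) (dFRS ∘ st)))))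

/-- `ascInitF ∈ FP`. [cite: AroraBarak2009, §1.3] -/
theorem ascInitF_mem_FP : ascInitF ∈ FP := by
  obtain ⟨hSd, hASd, _, hFRS, hVv⟩ := dproj_mem_FP
  have hst : sndPow 1 ∈ FP := sndPow_mem_FP 1
  exact fanoutFn_mem_FP (nthF_mem_FP 0) (fanoutFn_mem_FP (comp_mem_FP addFn_mem_FP (fanoutFn_mem_FP
      (comp_mem_FP lenBinF_mem_FP (comp_mem_FP yF_fuelF_mem_FP.2 (nthF_mem_FP 0))) (const_mem_FP _)))
    (fanoutFn_mem_FP (iteFn_mem_FP (comp_mem_FP eqPairFn_mem_FP (fanoutFn_mem_FP (comp_mem_FP hSd hst) (const_mem_FP _))) (const_mem_FP _)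
      (comp_mem_FP hSd hst)) (fanoutFn_mem_FP (comp_mem_FP hASd hst) (fanoutFn_mem_FP (comp_mem_FP hVv hst) (comp_mem_FP hFRS hst)))))

/-- The ascent record after a finished descent. [folklore] -/
theorem ascInitF_done (u : List Bool) (as as' : List (List Bool)) (h : IsZeroOneCode (inY u)) (cur frs : List Bool) (v : ℕ) :
    ascInitF (boolPair (boolPair u (ansEnc as)) (boolPair [] (dEnc [false] as' cur frs (encodeNat v)))) =
      boolPair (boolPair u (ansEnc as)) (boolPair (encodeNat (codeDim (inY u) + 1)) (aEnc [] as' v frs)) := by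
  have hf := length_fuelF u (ansEnc as)
  rw [h.1.1] at hf
  rw [ascInitF]
  simp only [fanoutFn_apply, Function.comp_apply]
  rw [iteFn_apply (b := true) (by simp [sndPow, eqPairFn_boolPair])]
  simp only [if_true, nthF_zero, fstF_boolPair, sndPow, Function.comp_apply, sndF_boolPair, dAS_dEnc, dV_dEnc, dFRS_dEnc, lenBinF_apply, hf,
    addFn_boolPair, bitsToNat_encodeNat, aEnc]
  rw [show bitsToNat [true] = 1 by simp [bitsToNat]]

/-- The ascent record after a pending descent keeps the pending status. [folklore] -/
theorem ascInitF_pending (u : List Bool) (as : List (List Bool)) (q rest : List Bool) :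
    ∃ rest', ascInitF (boolPair (boolPair u (ansEnc as)) (boolPair [] (boolPair (true :: q) rest))) =
      boolPair (boolPair u (ansEnc as)) (boolPair (encodeNat (codeFuel (inY u) + 1)) (boolPair (true :: q) rest')) := by
  refine ⟨boolPair (dAS (boolPair (true :: q) rest)) (boolPair (dV (boolPair (true :: q) rest)) (dFRS (boolPair (true :: q) rest))), ?_⟩
  rw [ascInitF]
  simp only [fanoutFn_apply, Function.comp_apply]
  rw [iteFn_apply (b := false) (by simp [sndPow, dS, eqPairFn_boolPair])]
  simp only [Bool.false_eq_true, if_false, nthF_zero, fstF_boolPair, sndPow, Function.comp_apply, sndF_boolPair, lenBinF_apply,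
    length_fuelF, addFn_boolPair, bitsToNat_encodeNat]
  rw [show bitsToNat [true] = 1 by simp [bitsToNat]]
  simp [dS]

/-- On the output `⟨inp, ⟨ε, ascent state⟩⟩` of the ascending loop: **the read-out** — running final state:
`1 bin (min P_Y n!)` (`n!` by `factUF` of the fuel); pending `1 q`: `0 q`. [cite: AaronsonArkhipovToC2013, proof of Thm. 4.3 (pp. 176–177)] -/
def stepOutF : List Bool → List Bool :=
  let st := sndPow 1
  let py := aPY ∘ st
  let nf := factUF ∘ polyFn X ∘ fuelF ∘ nthF 0
  iteFn (isNilFn ∘ aS ∘ st)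
    (List.cons true ∘ iteFn (ltFn ∘ fanoutFn py nf) py nf)
    (List.cons false ∘ dropFn ∘ fanoutFn (fun _ => [true]) (aS ∘ st))

/-- `stepOutF ∈ FP`. [cite: AroraBarak2009, §1.3] -/
theorem stepOutF_mem_FP : stepOutF ∈ FP := by
  obtain ⟨hSa, _, hPYa, _⟩ := aproj_mem_FP
  have hst : sndPow 1 ∈ FP := sndPow_mem_FP 1
  have hpy : (aPY ∘ sndPow 1) ∈ FP := comp_mem_FP hPYa hst
  have hnf : (factUF ∘ polyFn X ∘ fuelF ∘ nthF 0) ∈ FP :=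
    comp_mem_FP factF_mem_FP (comp_mem_FP (polyFn_mem_FP _) (comp_mem_FP yF_fuelF_mem_FP.2 (nthF_mem_FP 0)))
  exact iteFn_mem_FP (comp_mem_FP isNilFn_mem_FP (comp_mem_FP hSa hst))
    (comp_mem_FP (cons_mem_FP true) (iteFn_mem_FP (comp_mem_FP ltFn_mem_FP (fanoutFn_mem_FP hpy hnf)) hpy hnf))
    (comp_mem_FP (cons_mem_FP false) (comp_mem_FP dropFn_mem_FP (fanoutFn_mem_FP (const_mem_FP _) (comp_mem_FP hSa hst))))

/-- Read-out of a running final state: the clamped binary answer. [folklore] -/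
theorem stepOutF_done (u : List Bool) (as as' : List (List Bool)) (h : IsZeroOneCode (inY u)) (v : ℕ) (frs : List Bool) :
    stepOutF (boolPair (boolPair u (ansEnc as)) (boolPair [] (aEnc [] as' v frs))) = true :: encodeNat (min v (codeDim (inY u)).factorial) := by
  have hf := length_fuelF u (ansEnc as)
  rw [h.1.1] at hf
  rw [stepOutF, iteFn_apply (b := true) (by simp [isNilFn, sndPow])]
  have hlt : (ltFn ∘ fanoutFn (aPY ∘ sndPow 1) (factUF ∘ polyFn X ∘ fuelF ∘ nthF 0)) (boolPair (boolPair u (ansEnc as)) (boolPair [] (aEnc [] as' v frs))) =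
      [decide (v < (codeDim (inY u)).factorial)] := by
    simp [sndPow, factF_apply, hf, ones]
  simp only [if_true, Function.comp_apply, iteFn_apply hlt]
  by_cases hv : v < (codeDim (inY u)).factorial
  · rw [decide_eq_true hv, if_pos rfl, min_eq_left hv.le]; simp [sndPow]
  · rw [decide_eq_false hv, if_neg Bool.false_ne_true, min_eq_right (not_lt.1 hv)]; simp [factF_apply, hf, ones]

/-- Read-out of a pending final state: the query. [folklore] -/
theorem stepOutF_pending (inp q rest : List Bool) : stepOutF (boolPair inp (boolPair [] (boolPair (true :: q) rest))) = false :: q := by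
  rw [stepOutF, iteFn_apply (b := false) (by simp [isNilFn, sndPow, aS])]
  simp [sndPow, aS]

/-! ### The step function -/

/-- **The transcript step function of the randomised search, as a string function**: on `⟨u, transcript code⟩`,
if `inY u` is not a `0/1` matrix code answer `ε` (code `1`); else descend, ascend, read out. [cite: AaronsonArkhipovToC2013, proof of Thm. 4.3 (pp. 176–177) with proof of Thm. 1.1 (p. 178)] -/
def stepStr (G : ℕ) (c q₀ : Polynomial ℕ) : List Bool → List Bool :=
  iteFn code01T (stepOutF ∘ ascLoopF G c q₀ ∘ ascInitF ∘ descLoopF G c q₀ ∘ descInitF) fun _ => [true]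

/-- **`stepStr G c q₀ ∈ FP`.** [cite: AroraBarak2009, §1.3 (closure of polynomial time under composition and bounded loops)] -/
theorem stepStr_mem_FP (G : ℕ) (c q₀ : Polynomial ℕ) : stepStr G c q₀ ∈ FP :=
  iteFn_mem_FP code01T_mem_FP (comp_mem_FP stepOutF_mem_FP (comp_mem_FP (ascLoopF_mem_FP G c q₀) (comp_mem_FP ascInitF_mem_FP
    (comp_mem_FP (descLoopF_mem_FP G c q₀) descInitF_mem_FP)))) (const_mem_FP _)

/-- **Frames of the descent** from the empty stack: dimensions below the top one, first values read off the
transcript, at most `n` of them; the base value is `≤ 1` and the leftover transcript a suffix. [folklore] -/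
theorem descFramesW_frames (mk : Maker) :
    ∀ (n : ℕ) (w : List Bool) (hw : w.length = n * n) (fs : List WFrame) (as : List (List Bool)) (P : WFrame → Prop),
      (∀ f ∈ fs, P f) → (∀ (f : WFrame), f.n + 1 ≤ n → (∃ a ∈ as, f.v0 = decodeNat a) → P f) →
      match descFramesW mk n w hw fs as with
      | Sum.inl _ => True
      | Sum.inr (v, fs', as') => (∀ f ∈ fs', P f) ∧ fs'.length ≤ fs.length + n ∧ as' <:+ as ∧ v ≤ 1
  | 0, w, hw, fs, as, P, hfs, _ => ⟨hfs, by simp, List.suffix_refl _, le_rfl⟩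
  | n + 1, w, hw, fs, as, P, hfs, hP => by
    rw [descFramesW]
    rcases hro : replay (levelPre mk (wmat (n + 1) w)) as with q | ⟨_ | ⟨p, v0⟩, as'⟩
    · trivial
    · exact ⟨hfs, by omega, levelPre_none_suffix hro, Nat.zero_le _⟩
    · dsimp only
      obtain ⟨hv0, hsuf⟩ := levelPre_value_mem hro
      have ih := descFramesW_frames mk n (minorW n (permW (n + 1) w p)) (length_minorW_permW hw p) (⟨n, w, hw, p, v0⟩ :: fs) as' P
        (fun f hf => by
          rcases List.mem_cons.1 hf with rfl | hf
          · exact hP _ le_rfl hv0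
          · exact hfs f hf)
        (fun f hfn ⟨a, ha, hva⟩ => hP f (by omega) ⟨a, hsuf.subset ha, hva⟩)
      rcases hdf : descFramesW mk n (minorW n (permW (n + 1) w p)) (length_minorW_permW hw p) (⟨n, w, hw, p, v0⟩ :: fs) as' with q | ⟨v, fs', as''⟩
      · trivial
      · rw [hdf] at ih
        obtain ⟨h1, h2, h3, h4⟩ := ih
        exact ⟨h1, by simp at h2; omega, h3.trans hsuf, h4⟩

/-- **`stepStr` computes the `sumBool` code of the step function of the randomised search.** [cite: AaronsonArkhipovToC2013, proof of Thm. 4.3 (pp. 176–177) with proof of Thm. 1.1 (p. 178)] -/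
theorem stepStr_apply (G : ℕ) (c q₀ : Polynomial ℕ) (u : List Bool) (as : List (List Bool)) :
    stepStr G c q₀ (boolPair u ((encodingList Bool).listBool.encode as)) =
      ((encodingList Bool).sumBool (encodingList Bool)).encode (toStep (randComp G c q₀ u) as) := by
  rw [listBool_encode_eq_ansEnc, toStep_randComp, encodingIntMatrix_decode, stepStr, iteFn_apply (code01T_apply u _)]
  by_cases h : IsZeroOneCode (inY u)
  · rw [decide_eq_true h, if_pos rfl, if_pos h.1]
    set n := codeDim (inY u) with hn
    set y := inY u with hy
    have hz : isZeroOneEntries ⟨n, fun i j => intOfCode (codeEntry y i j)⟩ = true := by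
      simp only [isZeroOneEntries, decide_eq_true_eq]
      exact fun i j => h.2 i i.2 j j.2
    dsimp only
    rw [hz, if_pos rfl]
    -- the matrix is the matrix of the row-major word
    have hX : (Matrix.of fun i j : Fin n => intOfCode (codeEntry y i j)) = wmat n (plainWord y) := (wmat_plainWord h).symm
    have hnN : n ≤ (boolPair u (ansEnc as)).length := by
      rw [length_boolPair, hn, ← h.1.1, codeFuel]
      have h1 := length_fstF_sndF_le u
      have h2 := length_fstF_sndF_le (sndF u)
      have h3 := length_fstF_sndF_le (sndF (sndF u))
      have h4 := length_fstF_sndF_le (sndF (sndF (sndF u)))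
      change (fstF (sndF (inY u))).length ≤ _
      have : inY u = sndF (sndF u) := rfl
      rw [this]
      omega
    have hA := length_answers_le u as
    have hw : (plainWord y).length = n * n := length_plainWord y
    -- descend = descFrames then ascend; on words
    have hdd := descend_eq_descFrames (randMaker G c q₀ u) G n (wmat n (plainWord y)) [] as
    have hdw := descFrames_wmat (randMaker G c q₀ u) n (plainWord y) hw [] as
    rw [List.map_nil] at hdw
    rw [hdw] at hdd
    have hdesc := descLoopF_apply G c q₀ u (ansEnc as) n (plainWord y) hw hnN as hA
    have hfr := descFramesW_frames (randMaker G c q₀ u) n (plainWord y) hw [] as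
      (fun f => f.n + 1 ≤ (boolPair u (ansEnc as)).length ∧ (encodeNat f.v0).length ≤ (boolPair u (ansEnc as)).length + 1) (fun f hf => by simp at hf)
      (fun f hfn ⟨a, ha, hva⟩ => ⟨by omega, by rw [hva]; exact hA a ha⟩)
    simp only [Function.comp_apply, descInitF_apply u as h]
    rw [← hy, ← hn]
    rcases hdf : descFramesW (randMaker G c q₀ u) n (plainWord y) hw [] as with q | ⟨v, fs', as'⟩
    · -- pending in the descent: the ascent idles, the read-out emits the query
      rw [hdf] at hdesc hdd
      simp only [Sum.map_inl] at hdd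
      obtain ⟨rest, hrest⟩ := hdesc
      rw [hrest]
      obtain ⟨rest', hrest'⟩ := ascInitF_pending u as q rest
      rw [hrest', h.1.1, ← hn, ascLoopF_pending G c q₀ _ (by omega), stepOutF_pending, hX, hdd]
      rfl
    · -- the descent finished: ascend
      rw [hdf] at hdesc hdd hfr
      obtain ⟨cur, hcur⟩ := hdesc
      obtain ⟨hfs', hlen, hsuf, hv⟩ := hfr
      rw [hcur, ascInitF_done u as as' h cur (frsEnc fs') v, ← hn]
      have hA' : ∀ a ∈ as', (encodeNat (decodeNat a)).length ≤ (boolPair u (ansEnc as)).length + 1 := fun a ha => hA a (hsuf.subset ha)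
      have hasc := ascLoopF_apply G c q₀ u (ansEnc as) n hnN fs' (by simp at hlen; omega) hfs' hv as' hA'
      simp only [Sum.map_inr] at hdd
      rw [hX, hdd]
      rcases had : ascend (randMaker G c q₀ u) G v (fs'.map WFrame.toFrame) as' with q | ⟨v', as''⟩
      · rw [had] at hasc
        obtain ⟨rest, hrest⟩ := hasc
        rw [hrest, stepOutF_pending]
        rfl
      · rw [had] at hasc
        rw [hasc, stepOutF_done u as as'' h v' []]
        rfl
  · rw [decide_eq_false h, if_neg Bool.false_ne_true]
    by_cases hok : CodeOK (inY u)
    · rw [if_pos hok]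
      have hz : isZeroOneEntries ⟨codeDim (inY u), fun i j => intOfCode (codeEntry (inY u) i j)⟩ = false := by
        simp only [isZeroOneEntries, decide_eq_false_iff_not]
        intro h'
        exact h ⟨hok, fun i hi j hj => h' ⟨i, hi⟩ ⟨j, hj⟩⟩
      dsimp only
      rw [hz]
      rfl
    · rw [if_neg hok]
      rfl

end PerSearch

/-! ### The discharge -/

open _root_.Computability Complexity Complexity.OracleComp in
/-- **Discharge of the named fact `PerSearch.randSearchAlg_isPolyTime`**: the transcript step function of the
randomised AA13 search is polynomial-time computable — it is `toStep (randComp G c q₀ u) as`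
(`randSearchAlg_step`), computed on the coded pair by the `FP` string function `PerSearch.stepStr`
(`stepStr_apply`). Aaronson–Arkhipov, proof of Thm. 4.3 (p. 176): "we will show how to compute `Per(X)`
exactly, in polynomial time and using `O(g n² log n)` adaptive queries to `𝒪`". [cite: AaronsonArkhipovToC2013, Thm. 4.3, proof ("in polynomial time") (p. 176)] -/
theorem PerSearch.randSearchAlg_isPolyTime_holds : PerSearch.randSearchAlg_isPolyTime := by
  intro G c q₀
  obtain ⟨p, M, h⟩ := PerSearch.stepStr_mem_FP G c q₀
  refine ⟨p, M, fun q => ?_⟩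
  have hq := h (boolPair q.1 ((encodingList Bool).listBool.encode q.2))
  rw [id, PerSearch.stepStr_apply] at hq
  exact hq

end Literature.Computability.QuantumComplexity

end
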